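import Mathlib
import HarnessLib
import HarnessLib.Audit
import Summits.FinalStateConjecture.Statement
import Literature.Geometry.Lorentzian.KerrData
import Literature.Geometry.Lorentzian.WeightedNorms
import Literature.Geometry.Lorentzian.ModelData
import Literature.Geometry.Lorentzian.InitialDataPullback
import Literature.Geometry.Lorentzian.TrappedSurface
import Literature.Geometry.Lorentzian.InitialDataHomothety
import HarnessLib.Audit.Status.Attr

/-!
Route: RootDecompHorizonLadder

# Route RootDecompHorizonLadder — Root decomposition N1b «HorizonLadder» (form b) — KerrBasinLadder
leaves by signature (model cells, horizon-dominated and sub-Penrose residuals); apparent-horizon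
floor cut of 26561 as glued split

DECOMPOSITION CELL decomp-fsc (D-0178; doctrine D-0170/0171/0172), summit S =
`_root_.FinalStateConjecture` exactly as typed; LADDER rung 0 — NOTHING IN THIS FILE PROVES THE
FINAL STATE CONJECTURE. THIN OR-SIBLING (filing form (b), critic decomp-fsc-crit-1-g0 CLEARED
2026-08-30T03:49:27Z, standing rules 03:00:14Z / 03:45:00Z) of Theses/RootDecompKerrBasinLadder.lean
(route-FinalStateConjecture-RootDecompKerrBasinLadder, node N1, rev 1 fb8ebcbecfba:
ExtendedFieldResidual stmt-25091 split into HorizonDominatedResidual stmt-26560 ∧ SubPenroseResidual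
stmt-26561, glue stmt-26562): this file = node N1b «HorizonLadder» = lens decomp-fsc-lens-1 gen 3
«HorizonLadder v2» (HOME/decomp-fsc-lens-1/g3/HorizonLadder.lean @8334e482; critic re-check rc 0 · 0
sorry · axioms standard). The route is BORN with its top level BY SIGNATURE only —
NearExtremalCapture = stmt-25089, EnclosedCoreCapture = stmt-25090, PerturbativeCapture =
stmt-25092, SmallDataDispersal = stmt-25093, HorizonDominatedResidual = stmt-26560,
SubPenroseResidual = stmt-26561; `closes` over exactly these six (KerrBasinLadder's `closes` with
25091 rebuilt from its born children by excluded middle on the horizon guard; folder/n1c/glue.lean,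
native OK) — and the lens-1 g3 cut is then filed ON THIS ROUTE as the GLUED SPLIT of
SubPenroseResidual (`--split SubPenroseResidual --into SubdominantHorizonResidual
HorizonFreeResidual --glue 'SubdominantHorizonResidual → HorizonFreeResidual → SubPenroseResidual'`;
x-caps max_depth 1 forbids that split on KerrBasinLadder, where 26561 is already a child). The cut:
AH d := the born «let Hor» body with the Penrose-ratio conjunct dropped (apparent horizon present in
the born sense: floor rung p̄ = 0, kernel hor_zero_iff_apparentHorizonB); B₁
SubdominantHorizonResidual = guard «AH d ∧ ¬Hor d» (two-sided outermost MOTS present, enclosure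
Penrose ratio < 9/10; WEAKER · thin · IDEA-NEEDED + INSTRUMENTABLE T-H1′/T-H2′; relieved BY THEOREM
of the dispersal alternative: outermost MOTS + non-compact Cauchy surface ⟹ null-incomplete MGHD),
B₂ HorizonFreeResidual = guard «¬AH d» (horizon-free large data: the trapped-surface
FORMATION-vs-dispersal dichotomy; WEAKER · NEW RESIDUAL · INTERNAL NODE gen ≥ 4 — PARK RULE applies
to its next cut); free split ⇒ exact (26561 ⟺ B₁ ∧ B₂, kernel born_subPenroseResidual_iff_split
against the TREE decl via Iff.rfl links; split_iff₃ : 25091 ⟺ 26560 ∧ B₁ ∧ B₂). DOMINATION POINTER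
for provers served stmt-26561: «26561 ⟺ SubdominantHorizonResidual ∧ HorizonFreeResidual (exact);
attack the pieces, not 26561». The one-liners carry 26561's lets P/K/Mink/pert/collar/shell
BYTE-IDENTICAL (critic sha check), B₁ keeps the born Hor block and adds «let AH», B₂ replaces the
unused Hor let by «let AH» (common prefixes 6169 / 2858 of 6687 chars, writer check). The whole
AND/OR tree is kept in HOME/TREE.md (HOME = run/shared/lean/pub/decomp-fsc).
ROOT AND-node (exact, kernel `summit_iff_cells` in the writer's folder/n1/Sketch.lean = lens
`summit_iff_split` specialised): S ⟺ PerturbativeCapture ∧ NearExtremalCapture ∧ EnclosedCoreCapture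
∧ SmallDataDispersal ∧ ExtendedFieldResidual — a FREE POPULATION SPLIT of the exceptional set by
MEMBERSHIP OF THE BASE DATUM in four model cells (Kerr window cells 𝒦(β, W) for W = perturbative
window χ ≤ χ̄ horizon-penetrating / near-extremal collar χ̄ < χ < 1 / enclosed-core shell ρ₊(χ) ≤ ρ
≤ ρ̄; Minkowski cell 𝓜(β₀)) and their common complement (residual); cure target P_Σ verbatim, tame
genericity verbatim (one end, order 1, whole punctured line). Tags: NearExtremalCapture
[WEAKER·COUNTS — kernel `nearExtremalCapture_of_summit`; not emptied by print for ANY β (no basin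
uniform as χ → 1: Hintz Rem. 13.2); leaf IDEA-NEEDED + BARRIER (AretakisInstability) +
INSTRUMENTABLE (degeneration rate of ε(χ))]; EnclosedCoreCapture [WEAKER·COUNTS — kernel; open from
the first shell rung; leaf IDEA-NEEDED + INSTRUMENTABLE (close-limit / NR, ρ̄ = 3); COSTUME only in
the limit ρ̄ → ∞, not at ρ̄ = 3]; ExtendedFieldResidual [WEAKER·RESIDUAL near-wholesale — kernel;
carries stmt-17269 / stmt-17308 content; INTERNAL NODE for gen ≥ 1]; PerturbativeCapture [WEAKER,
UNDECIDED→DECORATIVE only in the limit β → 0⁺ (print: Klainerman–Szeftel + GKS + Shen χ ≪ 1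
refereed; Hintz 2026 claim χ < 1), at β = 1 OPEN-as-typed by effectivity/scale only — critic: NOT
COUNTED; leaf ATTACKABLE (porting of `klainerman_szeftel_kerr_stability_small_a_cauchy` /
`hintz_kerr_stability_subextremal_cauchy`) + IDEA-NEEDED (effective ε)]; SmallDataDispersal [WEAKER,
DECORATIVE in the limit β₀ → 0⁺ (CK93 `christodoulou_klainerman_stability_minkowski_cauchy`) — NOT
COUNTED; leaf ATTACKABLE (porting) + effective part IDEA-NEEDED]. No EQUIV layer; all five binders
load-bearing (cone 5); no theorem-emptied cell at the typed tuple (critic T3/T4); root genericity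
tame/one end/whole line (T5). Writer typing: every item ONE line over EXISTING declarations
(`Kerr.slice`, `Kerr.data`, `Kerr.Facts`, `Kerr.SliceFacts`, `InitialDataSet.comap`,
`InitialDataSet.dataWeightedSobolevEDist`, `Minkowski.slice`, `trivialData`; P_Σ, the cell predicate
K W and Mink and the three windows inlined with `let`), folder/n1/Sketch.lean rc 0, 0 sorry, 0
warnings (closes by four nested case splits; necessity ×5; `summit_iff_cells`). Lens node file
HOME/decomp-fsc-lens-1/KerrBasinLadder.lean
sha256=0b66b5d383cca76ab13f48d14c4b3959a276ff255d5520c0dfd97895e6f55335 (critic-checked @0b66b5d3;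
NODE line 01:26:52Z) + NODE.md; instrument data HOME/census/COSTUME-CENSUS-v1.md
sha256=17660d2f90b581bafa564c3770aecf7145cb0a799b3c1f57b10d96f2c53a4c91 (rows PR1–PR4 printed
basins, F2 caution c1: cells open in a topology finer than wDist). Why this is novel: no prior route
grades the data space of the typed summit by an explicit ladder of b-conormal Kerr tubes indexed by
spin collar and DRESSING DEPTH ρ̄ — the depth parameter interpolates between Hintz's
horizon-penetrating class and the Kerr-ended class of route ExactKerrEnds and isolates
«near-extremal capture» and «enclosed strong-field core» as separately typed S-implied cells.
Lean: `PerturbativeCapture ∧ NearExtremalCapture ∧ EnclosedCoreCapture ∧ SmallDataDispersal ∧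
HorizonDominatedResidual ∧ SubPenroseResidual` (the six by-signature decls of this file; `closes` in
folder/n1c/glue.lean; the lens-1 g3 pieces enter as the glued split of SubPenroseResidual)

## Assembly
Pure logic inside `closes` (folder/n1c/glue.lean, 0 sorry; kernel-checked in
folder/n1c/Sketch.lean): four excluded middles on cell membership of the datum (perturbative /
near-extremal / enclosed-core Kerr cells, Minkowski cell), then excluded middle on the born horizon
guard «Hor d» dispatching the residual to HorizonDominatedResidual or SubPenroseResidual —
KerrBasinLadder's `closes` with ExtendedFieldResidual (stmt-25091) rebuilt inline from its born
children (= the proved glue item stmt-26562, lens extendedFieldResidualGlue_holds).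

Rationale: WHY THIS LINE. A population split of the exceptional set with cure target P is free and exact
(critic `fsc_iff_cellSplit`; tame genericity is monotone and not ∧-closed, tree
`isTameChristodoulouGeneric_and_fails`), so the content is the choice of cells: here the level sets
of DISTANCE TO THE MODEL FAMILIES in the norm the printed stability theorems use (b-conormal
weighted Sobolev tubes: Christodoulou–Klainerman 1993 for Minkowski, Klainerman–Szeftel 2023 +
Giorgi–Klainerman–Szeftel arXiv:2205.14808 for slowly rotating Kerr, Hintz 2026 claim for the full
sub-extremal range, Dafermos–Holzegel–Rodnianski–Taylor 2021 for Schwarzschild), windowed by spin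
ratio and by how deep the Kerr dressing reaches (Corvino–Schoen 2006 / Kehle–Unger arXiv:2304.08455
gluing shows the shell cells are populated with arbitrary cores). Imported: weighted-Sobolev
perturbation theory of the model solutions as a GRADING of the data space, nothing conjectural. What
it does that prior routes do not: ExactKerrEnds conditions only the END (ρ̄ = ∞, δ-free); KerrBurial
/ QuietWindowCapture / EIHFluxBalance are all-data mechanisms; lens-5's capture cells sort by the
solution's FATE — this node sorts by the DATUM's position, making the near-extremal collar
(third-law / overspinning content, Sorce–Wald arXiv:1707.05862, Kehle–Unger arXiv:2211.15742) and
the enclosed core (close-limit regime, Price–Pullin gr-qc/9402039) separately attackable and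
instrumentable.

RANKED CRUXES. #2 NearExtremalCapture (crux) — = stmt on
route-FinalStateConjecture-RootDecompKerrBasinLadder reused BY SIGNATURE; PIECE rung 1a —
NearExtremalCapture at (s, δ, β, χ̄, ρ̄, β₀) = (6, −1, 1, 9/10, 3, 1) [WEAKER·COUNTS — critic
CLEARED[regime-fixed] 2026-08-30T01:33:24Z: «WEAKER·IDEA-NEEDED+BARRIER (counts)»; leaf IDEA-NEEDED
+ BARRIER (AretakisInstability prices any uniform-ε approach) + INSTRUMENTABLE (near-extremal QNM
damping ∝ √(1−χ), degeneration rate of ε(χ))]. For every Σ and every admissible P_Σ-exceptional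
datum d lying in the near-extremal Kerr window cell — granted the vendored Kerr facts, some
sub-extremal Kerr data (M, a, r₀) with 9/10 < |a|/M < 1 and horizon-penetrating depth 1 − √(1−χ²) <
r₀/M < 1 + √(1−χ²), and a smooth cocompact open embedding θ of the Kerr slice into Σ along which
θ^*d is b-conormal (finite H^s'_(−1) distance at every order) and 1-close at order 6 to the Kerr
data — there are one end e and a tame immersed injective one-parameter family F of admissible data
with F 0 = d whose members c ≠ 0 satisfy P_Σ. [difficulty: open-problem] (why it might fail: no
printed basin is uniform as χ → 1 and the extremal limit carries the Aretakis / zero-damped-mode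
instability; a near-extremal datum could overspin or hover at extremality along every tame curve
through it.) [arXiv:1707.05862, arXiv:2211.15742, arXiv:1910.02854, Hintz2026, arXiv:1206.6598]
#3 EnclosedCoreCapture (crux) — = stmt on route-FinalStateConjecture-RootDecompKerrBasinLadder
reused BY SIGNATURE; PIECE rung 1b — EnclosedCoreCapture at (s, δ, β, χ̄, ρ̄, β₀) = (6, −1, 1, 9/10,
3, 1) [WEAKER·COUNTS — critic: «WEAKER·IDEA-NEEDED·INSTRUMENTABLE (counts; COSTUME only as ρ̄ → ∞)»;
leaf INSTRUMENTABLE (close-limit / NR at ρ̄ = 3) + IDEA-NEEDED (large-data mechanism confined to a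
compact core: trapped-surface formation inside the hoop, then rung 0)]. For every Σ and every
admissible P_Σ-exceptional datum d lying in the enclosed-core shell cell — sub-extremal Kerr
dressing (b-conormal, 1-close at order 6, weight −1) along a cocompact embedded Kerr slice that
reaches only down to a sphere r₀ = ρM with 1 + √(1−χ²) ≤ ρ ≤ 3 (on or outside the horizon radius;
the core inside is arbitrary) — there are one end e and a tame immersed injective admissible
one-parameter family F with F 0 = d whose members c ≠ 0 satisfy P_Σ. [difficulty: open-problem] (why
it might fail: a strong-field core inside r ≤ 3M (near-critical packet inside its own hoop,
pre-merger binary) may form a naked singularity or a non-settling exterior robustly along tame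
curves — no theorem controls any core below the dressing sphere.) [arXiv:2304.08455,
arXiv:gr-qc/9402039, arXiv:0805.3880, CorvinoSchoen2006]
#4 SubPenroseResidual (crux) — = the BORN gen-1 child stmt-FinalStateConjecture-26561 of
ExtendedFieldResidual (stmt-25091) on route-FinalStateConjecture-RootDecompKerrBasinLadder, reused
BY SIGNATURE (dedup-attach; filing form (b), critic CLEARED 2026-08-30T03:49:27Z: this thin sibling
is born with its top level BY SIGNATURE only and the CLEARED lens-1 g3 cut «HorizonLadder v2»
(SubdominantHorizonResidual ∧ HorizonFreeResidual, exact: lens kernel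
born_subPenroseResidual_iff_split @8334e482, writer glue subPenroseResidual_of_pieces in
folder/n1c/Sketch.lean rc 0) is filed ON THIS ROUTE as the glued split of this item immediately
after birth); INTERNAL NODE; text as born: [crux · gen-2 glued split of ExtendedFieldResidual
(stmt-25091), lens-1 g2 node HorizonSplit, CLEARED 2026-08-30T02:58:30Z; child B = S-exit on R ∖
𝓗(9/10): residual data whose slice carries NO near-saturating apparent horizon — comparable-mass
multi-centre data (p ≲ 0.71), collapsing data not yet trapped on the slice (large-data collapse
threshold = weak cosmic censorship), extended incoming radiation, rough tails; WEAKER (kernel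
subPenroseResidualAt_of_summit; probes fail) · the NEW RESIDUAL, strictly weaker than the parent
exactly by the open rung A · INTERNAL NODE gen ≥ 3 · carries the hard cores stmt-17269 / stmt-17308
outside the model tubes; glue A → B → parent proved (writer folder/n1g2/Sketch.lean
extendedFieldResidual_of_split + split_iff, rc 0 / 0 sorry; lens HorizonSplit.glue); A_min
vocabulary (IsExteriorRegion / IsWeaklyOuterTrappedFree / IsOutsideOf / IsCalS /
minimalEnclosureArea) inlined as nested lets = VERBATIM transcription of the AFEnd.* defs of
Literature/Geometry/Lorentzian/EnclosureArea.lean (sha256/16 846bb3229da98cb0, Aug 15) because that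
module has NO olean on the farm (remote:stale:16:unbuilt, writer 03:01Z/03:05Z); critic must-fix
«import + AFEnd.* names» deferred to a tenure --restate (agreement Iff.rfl by construction) once it
builds — drift-watch in HOME/TREE.md] For every Σ and every admissible exceptional datum d outside
the four model cells with ¬ Hor(9/10) d: a tame order-1 immersed-at-0 injective curve of admissible
data through d, good off c = 0. [difficulty: open-problem] (why it might fail: This is large-data
weak cosmic censorship plus generic settling with no horizon on the slice: a tame-codimension-0 set
of naked-singularity or eternal few-body data anywhere below the Penrose ratio 9/10 refutes it (and
S).) [Christodoulou1999, arXiv:gr-qc/9910040, arXiv:1310.4209]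
#5 HorizonDominatedResidual (crux) — = the BORN gen-1 child stmt-FinalStateConjecture-26560 of
ExtendedFieldResidual (stmt-25091) on route-FinalStateConjecture-RootDecompKerrBasinLadder, reused
BY SIGNATURE; text as born: [crux · gen-2 glued split of ExtendedFieldResidual (stmt-25091), lens-1
g2 node HorizonSplit, CLEARED[+follow-ups F1–F3] by decomp-fsc-crit-1-g0 2026-08-30T02:58:30Z; child
A = S-exit on R ∩ 𝓗(9/10): the residual data (unit-far from every model tube of the born tuple
(6,−1,1,9/10,3,1)) whose slice carries an outermost MOTS S bounding the sole end's exterior,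
WOT-free outside, m_ADM > 0 and ENCLOSURE Penrose ratio √(A_min(S)/16π) ≥ (9/10)·m_ADM;
RESIDUAL-relieved · WEAKER (kernel horizonDominatedResidualAt_of_summit, split_iff; probes A → S / A
→ parent fail) · COUNTS-candidate → COUNTS once F1 (kernel Hor_core_iff_of_admissible on admissible
data) lands (critic 03:16:15Z: F2 inhabitant SATISFIED at print level — late slices of one-ended
collapse radiating < 19 %; F3: the p̄ = 1, k = 0 stratum is DECORATIVE-true either way and is NOT a
rung of this piece) · IDEA-NEEDED[U_rate] (caution c4 F8 topology mismatch applies to any porting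
reading) (no theorem evolves large vacuum data containing a MOTS to a settled exterior;
near-equality Penrose rigidity controls the exterior only weakly) · INSTRUMENTABLE (census
T-H1–T-H3); ceiling p̄ > 1 EMPTY under the corrected enclosure Penrose inequality as explicit
hypothesis (never in closes); A_min vocabulary (IsExteriorRegion / IsWeaklyOuterTrappedFree /
IsOutsideOf / IsCalS / minimalEnclosureArea) inlined as nested lets = VERBATIM transcription of the
AFEnd.* defs of Literature/Geometry/Lorentzian/EnclosureArea.lean (sha256/16 846bb3229da98cb0, Aug
15) because that module has NO olean on the farm (remote:stale:16:unbuilt, writer 03:01Z/03:05Z);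
critic must-fix «import + AFEnd.* names» deferred to a tenure --restate (agreement Iff.rfl by
construction) once it builds — drift-watch in HOME/TREE.md] For every Σ and every admissible
exceptional datum d outside the four model cells with Hor(9/10) d: a tame order-1 immersed-at-0
injective curve of admissible data through d, good off c = 0. [difficulty: open-problem] (why it
might fail: Near-saturating apparent horizons do not control the exterior in the H^s norms Kerr
stability consumes (Lee–Sormani, Allen, Dong: weak norms only); a laminated capture threshold inside
𝓗(9/10) (comparable spectators just under the 10 % budget) would defeat tame exits.)
[arXiv:1109.2165, arXiv:1705.00591, doi:10.2140/gt.2025.29.4911, arXiv:2304.08455,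
Christodoulou1999]
#6 PerturbativeCapture (crux) — = stmt on route-FinalStateConjecture-RootDecompKerrBasinLadder
reused BY SIGNATURE; PIECE rung 0→1 — PerturbativeCapture at (s, δ, β, χ̄, ρ̄, β₀) = (6, −1, 1,
9/10, 3, 1) [WEAKER; critic: «DECORATIVE-by-claim (β → 0⁺) / UNDECIDED[effective ε], ATTACKABLE
(porting) — NOT COUNTED»; at the typed β = 1 OPEN only by effectivity of the printed ε(M, χ) and
scale non-covariance (lens H2); leaf ATTACKABLE (porting
`klainerman_szeftel_kerr_stability_small_a_cauchy`, `hintz_kerr_stability_subextremal_cauchy`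
through the lens's `onCell_of_forall_settles`) + IDEA-NEEDED (effective basin radius)]. For every Σ
and every admissible P_Σ-exceptional datum d in the perturbative Kerr window cell (spin ratio ≤
9/10, horizon-penetrating depth, b-conormal and 1-close at order 6, weight −1, to sub-extremal Kerr
data along a cocompact embedded Kerr slice), there are one end e and a tame immersed injective
admissible one-parameter family F with F 0 = d whose members c ≠ 0 satisfy P_Σ. [difficulty: XL]
(why it might fail: β = 1 is an absolute radius while every printed basin ε(M, χ) is inexplicit and
non-uniform; data 1-close to a small-mass Kerr anchor are relatively large perturbations and may
collapse further or radiate away the hole.) [KlainermanSzeftel2023, arXiv:2205.14808, Hintz2026,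
arXiv:2104.08222]
#7 SmallDataDispersal (crux) — = stmt on route-FinalStateConjecture-RootDecompKerrBasinLadder reused
BY SIGNATURE; PIECE rung 0′ — SmallDataDispersal at (s, δ, β, χ̄, ρ̄, β₀) = (6, −1, 1, 9/10, 3, 1)
[WEAKER; critic: «same (CK93) — NOT COUNTED»; DECORATIVE in the limit β₀ → 0⁺ by
`christodoulou_klainerman_stability_minkowski_cauchy`; at β₀ = 1 open by effectivity only; leaf
ATTACKABLE (porting of gr.S07-cauchy) + effective part IDEA-NEEDED]. For every Σ and every
admissible P_Σ-exceptional datum d in the Minkowski cell (Σ globally a copy of ℝ³ via a surjective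
smooth open embedding θ of the Minkowski slice, θ^*d b-conormal and 1-close at order 6, weight −1,
to the trivial data), there are one end e and a tame immersed injective admissible one-parameter
family F with F 0 = d whose members c ≠ 0 satisfy P_Σ. [difficulty: XL] (why it might fail: no
explicit Christodoulou–Klainerman radius is in print; β₀ = 1 in H^6_(−1) may exceed the true
dispersive basin, letting some cell data collapse to a black hole whose settling is then the full
problem.) [ChristodoulouKlainerman1993, arXiv:2108.13379, LindbladRodnianski2010, Bieri2009]

TWO-LAYER PLAN. Foreseen (lens kernel `onCell_of_forall_settles`, `onCell_mono`,
`perturbativeCapture_anti`, `enclosedCoreCapture_anti`; not filed): PerturbativeCapture ⇐ (porting: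
one-ended Σ ⊇ cocompact Kerr slice ↦ slice data; MGHD existence; `ConvergesToKerr ⟹ Settles`) + an
EFFECTIVE basin radius ≥ 1 at order 6 — the second input is the open part; SmallDataDispersal
likewise from CK93. Gen-1 split owed on ExtendedFieldResidual (rough tails by gluing ∣ multi-centre
∣ extended radiation), where the sibling nodes' residual cells attach.

KILL CRITERIA. All five binders are S-implied in the kernel, so a refutation of any (an exceptional
datum 1-close to Kerr or to flat data with no tame escape curve; a robust naked singularity in a
shell-cell core) refutes the summit AS TYPED — route closes `refuted:<Decl>` and the statement audit
is alerted; no pivot inside this node. A different tuple is a different route (never restate in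
place). Superseded if a sibling root decomposition absorbs the collar and shell cells with finer
content.

NOT DECOMPOSED YET. ExtendedFieldResidual (the residual) is not decomposed at birth (gen-1 internal
node); the porting layer under PerturbativeCapture / SmallDataDispersal is not filed (ATTACKABLE,
shared with every FSC route); no second tuple is filed (one fixed tuple per route).

CHEAPEST FALSIFIER. NearExtremalCapture: census question «does any printed NONLINEAR result have a
basin uniform on χ ∈ (9/10, 1)?» — none ([corpus:arxiv-2302.06636 p.3] departures from Kerr
tantalised near extremality; Hintz Rem. 13.2 local uniformity only); a kill needs an overspinning
tame-open set. EnclosedCoreCapture: «a theorem settling ALL vacuum data equal to Kerr outside r =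
3M?» — none (Kehle–Unger arXiv:2304.08455 constructs examples only); instrument = close-limit / NR
at ρ̄ = 3, unrun (kit_allowed = false for the writer). PerturbativeCapture / SmallDataDispersal:
«explicit ε in print?» — none; consistent. Residual: inherits WCC (stmt-17269) — no cheap kill
known.

NUMBERS. Fixed tuple (s, δ, β, χ̄, ρ̄, β₀) = (6, −1, 1, 9/10, 3, 1): s = 6 (order of closeness), δ =
−1 (b-weight, CK range (−3/2, −1/2)), β = β₀ = 1 (absolute tube radii in `dataWeightedSobolevEDist 6
(−1)`), χ̄ = 9/10 (collar starts at spin ratio 0.9; NR remnant spins ≤ 0.95 on open sets,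
arXiv:1904.04831), ρ̄ = 3 (dressing sphere at most at 3M, the Schwarzschild photon sphere;
close-limit regime gr-qc/9402039). Printed basins: ε(M, χ) inexplicit (KS 2023 Thm 1.2.1; Hintz 2026
Thm 13.1), CK93 ε inexplicit.

DEFINITION REQUESTS. None filed. The Kerr window cell K W and the Minkowski cell are inlined `let`s
over Literature decls (`Kerr.data`, `InitialDataSet.comap`,
`InitialDataSet.dataWeightedSobolevEDist`, `trivialData`); if gen-1 reuses them, Literature-level
`InitialDataSet.IsKerrDressed s δ β W` / `IsNearTrivial s δ β₀` next to WeightedNorms would let the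
items be restated by name (definitionally equal). Dedup vs Literature:
`InitialDataSet.HasExactKerrEnd` (ExactKerrEnds) is the δ-free ρ̄ = ∞ analogue, cited not reused.

Novelty: Searches (2026-08-30, lens-1 + writer): the sub's Theses files read for Kerr-tube / end-conditioned
routes (nearest: ExactKerrEnds DRAFT — end only; KerrBurial, QuietWindowCapture, EIHFluxBalance —
all-data mechanisms; lens-5 RootDecompCaptureCells — fate cells); lit search --hybrid "nonlinear
stability Kerr basin uniform extremal limit" ([corpus:arxiv-2302.06636 p.3],
[corpus:arxiv-2205.14808], Hintz2026 tree fact docstring pp. 318–319); lit search --hybrid "gluing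
Kerr exterior arbitrary interior vacuum data event horizon gluing" ([corpus:arxiv-2402.10190 p.508
ref KU23], arXiv:2304.08455); lit galaxy search "close-limit|close limit
approximation|horizon-penetrating" --star all (textbook / review hits, no ladder-of-tubes
decomposition); writer's N5/N2 searches (no population-split hit); ledger negatives --problem
FinalStateConjecture (no refuted statement is a cell-cure statement; refuted all-data upgrades not
restated).
Nearest prior art found: Hintz2026 Thm 13.1 / KlainermanSzeftel2023 Thm 1.2.1 (the germ of
PerturbativeCapture); ChristodoulouKlainerman1993 (germ of SmallDataDispersal); Kehle–Unger
arXiv:2304.08455 (populates the shell cells); in-tree ExactKerrEnds (`HasExactKerrEnd`, ρ̄ = ∞).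
Delta: the data space of the typed summit is graded, exactly and for free, by explicit b-conormal
tubes around the model families windowed by spin collar and dressing depth, so that near-extremal
capture and enclosed-core capture become separately typed S-implied cells between the p  [refs: 2304.08455, arxiv-2302.06636, arxiv-2205.14808, arxiv-2402.10190, Hintz2026, KlainermanSzeftel2023, ChristodoulouKlainerman1993]

Barriers (technique_class: population-split, Kerr-basin-ladder, b-conormal tubes): - technique_class: population-split, Kerr-basin-ladder, b-conormal tubes
- Literature.Barriers.FinalStateConjecture.AretakisInstability: bites NearExtremalCapture head-on
(no uniform-in-spin control up to |a| = M; transversal-derivative growth on extremal horizons) —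
declared as that piece's BARRIER tag, not evaded; the bet is a dynamical third-law / no-overspinning
mechanism for perturbations large relative to the shrinking basin; the other four pieces stay at
spin ≤ 9/10 or away from horizons.
- Literature.Barriers.FinalStateConjecture.AretakisInstabilityNarrow: same placement for the collar
cell; recorded.
- Literature.Barriers.FinalStateConjecture.SlowlyRotatingKerrFrontier: PerturbativeCapture at χ̄ =
9/10 lies beyond the refereed slowly-rotating range (KS 2023) and leans on the unrefereed full-range
claim (Hintz 2026) for its germ — acknowledged; the piece is not counted as content.
- Literature.Barriers.FinalStateConjecture.KerrStabilityHoldsBelowNarrow: the printed small-|a|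
stability does NOT empty the perturbative cell at the typed β = 1 (ε inexplicit, absolute units) —
so PerturbativeCapture is not a restated theorem (critic T3), and it is tagged
decorative-in-the-limit, not counted.
- Literature.Barriers.FinalStateConjecture.KerrSuperradiance: decay-estimate barrier for the linear
roads under the capture pieces; binders are data-side cure statements — outside; porting roads meet
it as the printed proofs do.
- Literature.Barriers.FinalStateConjecture.SbierskiTrappi

sub-problem: FinalStateConjecture · status: draft · opened planner-decomp-fsc-writer-1-g0-0 2026-08-30T03:58:38Z · rev 2 · ledger route-FinalStateConjecture-RootDecompHorizonLadder
GENERATED by the gate from the ledger (D-0016/17). Provers cite these decls: `theorem foo : Summit.FinalStateConjecture.FinalStateConjecture.Theses.RootDecompHorizonLadder.<Decl> := …` in Summits/FinalStateConjecture/FinalStateConjecture/Theorems/<Name>.lean.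
-/

namespace Summit.FinalStateConjecture.FinalStateConjecture.Theses.RootDecompHorizonLadder

open scoped BigOperators Topology Manifold Classical MeasureTheory ProbabilityTheory Matrix InnerProductSpace ComplexConjugate ContinuousMap
open Filter Set Function TopologicalSpace MeasureTheory

attribute [summit_statement] _root_.FinalStateConjecture

/-- item stmt-FinalStateConjecture-25089 · crux · rank 2 · open · by planner
why it might fail: no printed basin is uniform as χ → 1 and the extremal limit carries the Aretakis / zero-damped-mode instability; a near-extremal datum could overspin or hover at extremality along every tame curve through it.
sources: arXiv:1707.05862, arXiv:2211.15742, arXiv:1910.02854, Hintz2026, arXiv:1206.6598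
[crux] PIECE rung 1a — NearExtremalCapture at (s, δ, β, χ̄, ρ̄, β₀) = (6, −1, 1, 9/10, 3, 1)
[WEAKER·COUNTS — critic CLEARED[regime-fixed] 2026-08-30T01:33:24Z: «WEAKER·IDEA-NEEDED+BARRIER
(counts)»; leaf IDEA-NEEDED + BARRIER (AretakisInstability prices any uniform-ε approach) +
INSTRUMENTABLE (near-extremal QNM damping ∝ √(1−χ), degeneration rate of ε(χ))]. For every Σ and
every admissible P_Σ-exceptional datum d lying in the near-extremal Kerr window cell — granted the
vendored Kerr facts, some sub-extremal Kerr data (M, a, r₀) with 9/10 < |a|/M < 1 and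
horizon-penetrating depth 1 − √(1−χ²) < r₀/M < 1 + √(1−χ²), and a smooth cocompact open embedding θ
of the Kerr slice into Σ along which θ^*d is b-conormal (finite H^s'_(−1) distance at every order)
and 1-close at order 6 to the Kerr data — there are one end e and a tame immersed injective
one-parameter family F of admissible data with F 0 = d whose members c ≠ 0 satisfy P_Σ. [difficulty:
open-problem] -/
@[route_item "route-FinalStateConjecture-RootDecompHorizonLadder", crux]
def NearExtremalCapture : Prop :=
  ∀ (X : Type) [TopologicalSpace X] [ChartedSpace Literature.Geometry.Lorentzian.E3 X] [IsManifold (𝓡 3) ((⊤ : ℕ∞) : WithTop ℕ∞) X] [T2Space X] [SecondCountableTopology X] [ConnectedSpace X], let P : Literature.Geometry.Lorentzian.InitialDataSet (𝓡 3) X → Prop := fun D ↦ (∃ 𝒟 : Literature.Geometry.Lorentzian.VacuumCauchyDevelopment D, 𝒟.IsMaximal) ∧ ∀ 𝒟 : Literature.Geometry.Lorentzian.VacuumCauchyDevelopment D, 𝒟.IsMaximal → Summit.FinalStateConjecture.HasCompleteNullInfinity 𝒟.toCauchyDevelopment ∧ ∃ (O : Set 𝒟.carrier) (d : Literature.Geometry.Lorentzian.FinalStateDecomposition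 𝒟.toSpacetime O 2), (∀ i, Literature.Geometry.Lorentzian.Kerr.IsSubextremal (d.mass i) (d.spin i)) ∧ O = Summit.FinalStateConjecture.exteriorOf 𝒟.toCauchyDevelopment d.charted ∧ Summit.FinalStateConjecture.RaysStayInClosure 𝒟.toCauchyDevelopment O ∧ Summit.FinalStateConjecture.HasExhaustiveCharts d ∧ Summit.FinalStateConjecture.IsFutureOriented d; let K : Set (ℝ × ℝ) → Literature.Geometry.Lorentzian.InitialDataSet (𝓡 3) X → Prop := fun W D ↦ ∀ [Literature.Geometry.Lorentzian.Kerr.Facts] [Literature.Geometry.Lorentzian.Kerr.SliceFacts], ∃ (M a r₀ : ℝ) (hM : 0 < M), |a| < M ∧ (|a| / M, r₀ / M) ∈ W ∧ ∃ (θ : Literature.Geometry.Lorentzian.Kerr.slice a r₀ → X) (hθ : ContMDiff 𝓘(ℝ, Literature.Geometry.Lorentzian.E3) (𝓡 3) (((⊤ : ℕ∞) : WithTop ℕ∞) + 1) θ) (hθ' : ∀ u, Injective (mfderiv 𝓘(ℝ, Literature.Geometry.Lorentzian.E3) (𝓡 3) θ u)), Topology.IsOpenEmbedding θ ∧ IsCompact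 (range θ)ᶜ ∧ (∀ s' : ℕ, Literature.Geometry.Lorentzian.InitialDataSet.dataWeightedSobolevEDist s' (-1 : ℝ) (D.comap θ hθ hθ') (Literature.Geometry.Lorentzian.Kerr.data M a r₀ hM.le) < ⊤) ∧ Literature.Geometry.Lorentzian.InitialDataSet.dataWeightedSobolevEDist 6 (-1 : ℝ) (D.comap θ hθ hθ') (Literature.Geometry.Lorentzian.Kerr.data M a r₀ hM.le) < ENNReal.ofReal 1; let collar : Set (ℝ × ℝ) := {p | (9 / 10 : ℝ) < p.1 ∧ 1 - Real.sqrt (1 - p.1 ^ 2) < p.2 ∧ p.2 < 1 + Real.sqrt (1 - p.1 ^ 2)}; ∀ d ∈ Literature.Geometry.Lorentzian.admissibleVacuumData X, ¬ P d → K collar d → ∃ (e : Literature.Geometry.Lorentzian.AFEnd X) (F : EuclideanSpace ℝ (Fin 1) → Literature.Geometry.Lorentzian.InitialDataSet (𝓡 3) X), Literature.Geometry.Lorentzian.InitialDataSet.IsTameDataFamily e 1 F ∧ Literature.Geometry.Lorentzian.InitialDataSet.IsImmersedAtZero 1 F ∧ F 0 = d ∧ Injective F ∧ (∀ c, F c ∈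 Literature.Geometry.Lorentzian.admissibleVacuumData X) ∧ ∀ c ≠ 0, P (F c)

/-- item stmt-FinalStateConjecture-25090 · crux · rank 3 · open · by planner
why it might fail: a strong-field core inside r ≤ 3M (near-critical packet inside its own hoop, pre-merger binary) may form a naked singularity or a non-settling exterior robustly along tame curves — no theorem controls any core below the dressing sphere.
sources: arXiv:2304.08455, arXiv:gr-qc/9402039, arXiv:0805.3880, CorvinoSchoen2006
[crux] PIECE rung 1b — EnclosedCoreCapture at (s, δ, β, χ̄, ρ̄, β₀) = (6, −1, 1, 9/10, 3, 1)
[WEAKER·COUNTS — critic: «WEAKER·IDEA-NEEDED·INSTRUMENTABLE (counts; COSTUME only as ρ̄ → ∞)»; leaf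
INSTRUMENTABLE (close-limit / NR at ρ̄ = 3) + IDEA-NEEDED (large-data mechanism confined to a
compact core: trapped-surface formation inside the hoop, then rung 0)]. For every Σ and every
admissible P_Σ-exceptional datum d lying in the enclosed-core shell cell — sub-extremal Kerr
dressing (b-conormal, 1-close at order 6, weight −1) along a cocompact embedded Kerr slice that
reaches only down to a sphere r₀ = ρM with 1 + √(1−χ²) ≤ ρ ≤ 3 (on or outside the horizon radius;
the core inside is arbitrary) — there are one end e and a tame immersed injective admissible
one-parameter family F with F 0 = d whose members c ≠ 0 satisfy P_Σ. [difficulty: open-problem] -/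
@[route_item "route-FinalStateConjecture-RootDecompHorizonLadder", crux]
def EnclosedCoreCapture : Prop :=
  ∀ (X : Type) [TopologicalSpace X] [ChartedSpace Literature.Geometry.Lorentzian.E3 X] [IsManifold (𝓡 3) ((⊤ : ℕ∞) : WithTop ℕ∞) X] [T2Space X] [SecondCountableTopology X] [ConnectedSpace X], let P : Literature.Geometry.Lorentzian.InitialDataSet (𝓡 3) X → Prop := fun D ↦ (∃ 𝒟 : Literature.Geometry.Lorentzian.VacuumCauchyDevelopment D, 𝒟.IsMaximal) ∧ ∀ 𝒟 : Literature.Geometry.Lorentzian.VacuumCauchyDevelopment D, 𝒟.IsMaximal → Summit.FinalStateConjecture.HasCompleteNullInfinity 𝒟.toCauchyDevelopment ∧ ∃ (O : Set 𝒟.carrier) (d : Literature.Geometry.Lorentzian.FinalStateDecomposition 𝒟.toSpacetime O 2), (∀ i, Literature.Geometry.Lorentzian.Kerr.IsSubextremal (d.mass i) (d.spin i)) ∧ O = Summit.FinalStateConjecture.exteriorOf 𝒟.toCauchyDevelopment d.charted ∧ Summit.FinalStateConjecture.RaysStayInClosure 𝒟.toCauchyDevelopment O ∧ Summit.FinalStateConjecture.HasExhaustiveCharts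 d ∧ Summit.FinalStateConjecture.IsFutureOriented d; let K : Set (ℝ × ℝ) → Literature.Geometry.Lorentzian.InitialDataSet (𝓡 3) X → Prop := fun W D ↦ ∀ [Literature.Geometry.Lorentzian.Kerr.Facts] [Literature.Geometry.Lorentzian.Kerr.SliceFacts], ∃ (M a r₀ : ℝ) (hM : 0 < M), |a| < M ∧ (|a| / M, r₀ / M) ∈ W ∧ ∃ (θ : Literature.Geometry.Lorentzian.Kerr.slice a r₀ → X) (hθ : ContMDiff 𝓘(ℝ, Literature.Geometry.Lorentzian.E3) (𝓡 3) (((⊤ : ℕ∞) : WithTop ℕ∞) + 1) θ) (hθ' : ∀ u, Injective (mfderiv 𝓘(ℝ, Literature.Geometry.Lorentzian.E3) (𝓡 3) θ u)), Topology.IsOpenEmbedding θ ∧ IsCompact (range θ)ᶜ ∧ (∀ s' : ℕ, Literature.Geometry.Lorentzian.InitialDataSet.dataWeightedSobolevEDist s' (-1 : ℝ) (D.comap θ hθ hθ') (Literature.Geometry.Lorentzian.Kerr.data M a r₀ hM.le) < ⊤) ∧ Literature.Geometry.Lorentzian.InitialDataSet.dataWeightedSobolevEDist 6 (-1 : ℝ)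 (D.comap θ hθ hθ') (Literature.Geometry.Lorentzian.Kerr.data M a r₀ hM.le) < ENNReal.ofReal 1; let shell : Set (ℝ × ℝ) := {p | 1 + Real.sqrt (1 - p.1 ^ 2) ≤ p.2 ∧ p.2 ≤ 3}; ∀ d ∈ Literature.Geometry.Lorentzian.admissibleVacuumData X, ¬ P d → K shell d → ∃ (e : Literature.Geometry.Lorentzian.AFEnd X) (F : EuclideanSpace ℝ (Fin 1) → Literature.Geometry.Lorentzian.InitialDataSet (𝓡 3) X), Literature.Geometry.Lorentzian.InitialDataSet.IsTameDataFamily e 1 F ∧ Literature.Geometry.Lorentzian.InitialDataSet.IsImmersedAtZero 1 F ∧ F 0 = d ∧ Injective F ∧ (∀ c, F c ∈ Literature.Geometry.Lorentzian.admissibleVacuumData X) ∧ ∀ c ≠ 0, P (F c)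

/-- item stmt-FinalStateConjecture-26561 · crux · rank 4 · SPLIT (gen 1) into SubdominantHorizonResidual, HorizonFreeResidual + glue SubPenroseResidualGlue · direct attempts still welcome (low priority) · by planner
why it might fail: This is large-data weak cosmic censorship plus generic settling with no horizon on the slice: a tame-codimension-0 set of naked-singularity or eternal few-body data anywhere below the Penrose ratio 9/10 refutes it (and S).
sources: Christodoulou1999, arXiv:gr-qc/9910040, arXiv:1310.4209
[crux · gen-2 glued split of ExtendedFieldResidual (stmt-25091), lens-1 g2 node HorizonSplit,
CLEARED 2026-08-30T02:58:30Z; child B = S-exit on R ∖ 𝓗(9/10): residual data whose slice carries NO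
near-saturating apparent horizon — comparable-mass multi-centre data (p ≲ 0.71), collapsing data not
yet trapped on the slice (large-data collapse threshold = weak cosmic censorship), extended incoming
radiation, rough tails; WEAKER (kernel subPenroseResidualAt_of_summit; probes fail) · the NEW
RESIDUAL, strictly weaker than the parent exactly by the open rung A · INTERNAL NODE gen ≥ 3 ·
carries the hard cores stmt-17269 / stmt-17308 outside the model tubes; glue A → B → parent proved
(writer folder/n1g2/Sketch.lean extendedFieldResidual_of_split + split_iff, rc 0 / 0 sorry; lens
HorizonSplit.glue); A_min vocabulary (IsExteriorRegion / IsWeaklyOuterTrappedFree / IsOutsideOf /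
IsCalS / minimalEnclosureArea) inlined as nested lets = VERBATIM transcription of the AFEnd.* defs
of Literature/Geometry/Lorentzian/EnclosureArea.lean (sha256/16 846bb3229da98cb0, Aug 15) because
that module has NO olean on the farm (remote:stale:16:unbuilt, writer 03:01Z/03:05Z); critic
must-fix «import + AFEnd.* name -/
@[route_item "route-FinalStateConjecture-RootDecompHorizonLadder", crux]
def SubPenroseResidual : Prop :=
  ∀ (X : Type) [TopologicalSpace X] [ChartedSpace Literature.Geometry.Lorentzian.E3 X] [IsManifold (𝓡 3) ((⊤ : ℕ∞) : WithTop ℕ∞) X] [T2Space X] [SecondCountableTopology X] [ConnectedSpace X], let P : Literature.Geometry.Lorentzian.InitialDataSet (𝓡 3) X → Prop := fun D ↦ (∃ 𝒟 : Literature.Geometry.Lorentzian.VacuumCauchyDevelopment D, 𝒟.IsMaximal) ∧ ∀ 𝒟 : Literature.Geometry.Lorentzian.VacuumCauchyDevelopment D, 𝒟.IsMaximal → Summit.FinalStateConjecture.HasCompleteNullInfinity 𝒟.toCauchyDevelopment ∧ ∃ (O : Set 𝒟.carrier) (d : Literature.Geometry.Lorentzian.FinalStateDecomposition 𝒟.toSpacetime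 O 2), (∀ i, Literature.Geometry.Lorentzian.Kerr.IsSubextremal (d.mass i) (d.spin i)) ∧ O = Summit.FinalStateConjecture.exteriorOf 𝒟.toCauchyDevelopment d.charted ∧ Summit.FinalStateConjecture.RaysStayInClosure 𝒟.toCauchyDevelopment O ∧ Summit.FinalStateConjecture.HasExhaustiveCharts d ∧ Summit.FinalStateConjecture.IsFutureOriented d; let K : Set (ℝ × ℝ) → Literature.Geometry.Lorentzian.InitialDataSet (𝓡 3) X → Prop := fun W D ↦ ∀ [Literature.Geometry.Lorentzian.Kerr.Facts] [Literature.Geometry.Lorentzian.Kerr.SliceFacts], ∃ (M a r₀ : ℝ) (hM : 0 < M), |a| < M ∧ (|a| / M, r₀ / M) ∈ W ∧ ∃ (θ : Literature.Geometry.Lorentzian.Kerr.slice a r₀ → X) (hθ : ContMDiff 𝓘(ℝ, Literature.Geometry.Lorentzian.E3) (𝓡 3) (((⊤ : ℕ∞) : WithTop ℕ∞) + 1) θ) (hθ' : ∀ u, Injective (mfderiv 𝓘(ℝ, Literature.Geometry.Lorentzian.E3) (𝓡 3) θ u)), Topology.IsOpenEmbedding θ ∧ IsCompact (range θ)ᶜ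 ∧ (∀ s' : ℕ, Literature.Geometry.Lorentzian.InitialDataSet.dataWeightedSobolevEDist s' (-1 : ℝ) (D.comap θ hθ hθ') (Literature.Geometry.Lorentzian.Kerr.data M a r₀ hM.le) < ⊤) ∧ Literature.Geometry.Lorentzian.InitialDataSet.dataWeightedSobolevEDist 6 (-1 : ℝ) (D.comap θ hθ hθ') (Literature.Geometry.Lorentzian.Kerr.data M a r₀ hM.le) < ENNReal.ofReal 1; let Mink : Literature.Geometry.Lorentzian.InitialDataSet (𝓡 3) X → Prop := fun D ↦ ∃ (θ : Literature.Geometry.Lorentzian.Minkowski.slice → X) (hθ : ContMDiff 𝓘(ℝ, Literature.Geometry.Lorentzian.E3) (𝓡 3) (((⊤ : ℕ∞) : WithTop ℕ∞) + 1) θ) (hθ' : ∀ u, Injective (mfderiv 𝓘(ℝ, Literature.Geometry.Lorentzian.E3) (𝓡 3) θ u)), Topology.IsOpenEmbedding θ ∧ Surjective θ ∧ (∀ s' : ℕ, Literature.Geometry.Lorentzian.InitialDataSet.dataWeightedSobolevEDist s' (-1 : ℝ) (D.comap θ hθ hθ') Literature.Geometry.Lorentzian.trivialData < ⊤) ∧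 Literature.Geometry.Lorentzian.InitialDataSet.dataWeightedSobolevEDist 6 (-1 : ℝ) (D.comap θ hθ hθ') Literature.Geometry.Lorentzian.trivialData < ENNReal.ofReal 1; let pert : Set (ℝ × ℝ) := {p | p.1 ≤ (9 / 10 : ℝ) ∧ 1 - Real.sqrt (1 - p.1 ^ 2) < p.2 ∧ p.2 < 1 + Real.sqrt (1 - p.1 ^ 2)}; let collar : Set (ℝ × ℝ) := {p | (9 / 10 : ℝ) < p.1 ∧ 1 - Real.sqrt (1 - p.1 ^ 2) < p.2 ∧ p.2 < 1 + Real.sqrt (1 - p.1 ^ 2)}; let shell : Set (ℝ × ℝ) := {p | 1 + Real.sqrt (1 - p.1 ^ 2) ≤ p.2 ∧ p.2 ≤ 3}; let Hor : Literature.Geometry.Lorentzian.InitialDataSet (𝓡 3) X → Prop := fun D ↦ ∃ (hLC : D.metric.HasLeviCivita) (e : Literature.Geometry.Lorentzian.AFEnd X) (S : Literature.Geometry.Lorentzian.OutermostMOTS (𝓡 3) D.h D.k), haveI : (Literature.Geometry.Lorentzian.PseudoRiemannianMetric.ofRiemannian D.h).HasLeviCivita := hLC; let IsExteriorRegion : TopologicalSpace.Opens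 X → Prop := fun U ↦ IsConnected (U : Set X) ∧ ∃ R', e.R < R' ∧ e.far R' ⊆ (U : Set X) ∧ IsCompact (closure (U : Set X) \ e.far R'); let IsOutsideOf : TopologicalSpace.Opens X → (S' : Type) → (f' : S' → X) → Literature.Geometry.Lorentzian.NormalField (𝓡 3) f' → Prop := fun U _ f' ν' ↦ frontier (U : Set X) = Set.range f' ∧ (∀ y, ∀ᶠ t in nhdsWithin (0 : ℝ) (Set.Ioi 0), Literature.Geometry.Lorentzian.curveThrough (𝓡 3) (f' y) (ν' y) t ∈ (U : Set X)) ∧ (∀ y, ∀ᶠ t in nhdsWithin (0 : ℝ) (Set.Iio 0), Literature.Geometry.Lorentzian.curveThrough (𝓡 3) (f' y) (ν' y) t ∉ closure (U : Set X)) ∧ IsExteriorRegion U; let IsCalS : TopologicalSpace.Opens X → Prop := fun V ↦ ∃ (S' : Type) (_ : TopologicalSpace S') (_ : ChartedSpace (EuclideanSpace ℝ (Fin 2)) S') (_ : IsManifold (𝓡 2) ((⊤ : ℕ∞) : WithTop ℕ∞) S') (_ : CompactSpace S') (_ : T2Space S') (f' : S' → X) (ν' : Literature.Geometry.Lorentzian.NormalField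 (𝓡 3) f'), Manifold.IsSmoothEmbedding (𝓡 2) (𝓡 3) ((⊤ : ℕ∞) : WithTop ℕ∞) f' ∧ (Literature.Geometry.Lorentzian.PseudoRiemannianMetric.ofRiemannian D.h).IsUnitNormal (𝓡 2) f' ν' 1 ∧ IsOutsideOf V S' f' ν'; let WOTFree : TopologicalSpace.Opens X → Prop := fun U ↦ ∀ (S' : Type) [TopologicalSpace S'] [ChartedSpace (EuclideanSpace ℝ (Fin 2)) S'] [IsManifold (𝓡 2) ((⊤ : ℕ∞) : WithTop ℕ∞) S'] [CompactSpace S'] [T2Space S'] (f' : S' → X) (ν' : Literature.Geometry.Lorentzian.NormalField (𝓡 3) f') (hpb' : Literature.Geometry.Lorentzian.PseudoRiemannianMetric.contMDiff_pullbackBilin (𝓡 3) X (𝓡 2) S' ((⊤ : ℕ∞) : WithTop ℕ∞)) (hf' : (Literature.Geometry.Lorentzian.PseudoRiemannianMetric.ofRiemannian D.h).IsSpacelikeImmersion (𝓡 2) f') (Ω : TopologicalSpace.Opens X), Manifold.IsSmoothEmbedding (𝓡 2) (𝓡 3) ((⊤ : ℕ∞) : WithTop ℕ∞) f' → Set.range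 f' ⊆ (U : Set X) → (Literature.Geometry.Lorentzian.PseudoRiemannianMetric.ofRiemannian D.h).IsUnitNormal (𝓡 2) f' ν' 1 → Nonempty S' → frontier (Ω : Set X) = Set.range f' → (∃ R', e.R < R' ∧ Disjoint (e.far R') (Ω : Set X)) → (∀ y, ∀ᶠ t in nhdsWithin (0 : ℝ) (Set.Iio 0), Literature.Geometry.Lorentzian.curveThrough (𝓡 3) (f' y) (ν' y) t ∈ (Ω : Set X)) → ¬ Literature.Geometry.Lorentzian.IsWeaklyOuterTrapped D.h D.k f' hpb' hf' ν'; ContMDiff (𝓡 2) (𝓡 3).tangent ((⊤ : ℕ∞) : WithTop ℕ∞) (fun y ↦ (Bundle.TotalSpace.mk' Literature.Geometry.Lorentzian.E3 (S.f y) (S.ν y) : TangentBundle (𝓡 3) X)) ∧ D.SatisfiesDominantEnergyCondition ∧ e.IsAsymptoticallyFlat D 1 ∧ D.IsComplete ∧ (∃ m, e.HasADMEnergy D m) ∧ (∀ i, ∃ p, e.HasADMMomentum D i p) ∧ WOTFree S.exterior ∧ IsOutsideOf S.exterior S.surf S.f S.ν ∧ 0 < e.admMass D ∧ (letI : MeasurableSpace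 X := borel X; haveI : BorelSpace X := ⟨rfl⟩; haveI : LocallyCompactSpace X := ChartedSpace.locallyCompactSpace Literature.Geometry.Lorentzian.E3 X; (9 / 10 : ℝ) * e.admMass D ≤ Real.sqrt ((⨅ (V : TopologicalSpace.Opens X) (_ : IsCalS V ∧ V ≤ S.exterior), Literature.Geometry.Lorentzian.area D.h (frontier (V : Set X))).toReal / (16 * Real.pi))); ∀ d ∈ Literature.Geometry.Lorentzian.admissibleVacuumData X, ¬ P d → (¬ K pert d ∧ ¬ K collar d ∧ ¬ K shell d ∧ ¬ Mink d) → ¬ Hor d → ∃ (e : Literature.Geometry.Lorentzian.AFEnd X) (F : EuclideanSpace ℝ (Fin 1) → Literature.Geometry.Lorentzian.InitialDataSet (𝓡 3) X), Literature.Geometry.Lorentzian.InitialDataSet.IsTameDataFamily e 1 F ∧ Literature.Geometry.Lorentzian.InitialDataSet.IsImmersedAtZero 1 F ∧ F 0 = d ∧ Injective F ∧ (∀ c, F c ∈ Literature.Geometry.Lorentzian.admissibleVacuumData X) ∧ ∀ c ≠ 0, P (F c)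

-- parent: SubPenroseResidual · child (gen 1)
/--     item stmt-FinalStateConjecture-27211 · crux · rank 401 · open
    parent: SubPenroseResidual · by planner
    why it might fail: capture given a certified but subdominant hole is open far from Kerr: comparable-mass two-hole data (Brill–Lindquist/Misner beyond the common-MOTS fold) may radiate, recoil or fragment so that no tame line through d reaches P; the born MOTS guard is slicing-sensitive (Wald–Iyer).
    sources: arXiv:1109.2165, arXiv:gr-qc/9910040, Christodoulou1999, arXiv:1310.4209, doi:10.1007/978-3-662-46035-1
[crux · gen-3 glued split of SubPenroseResidual (stmt-26561), lens-1 g3 node «HorizonLadder v2»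
(HOME/decomp-fsc-lens-1/g3/HorizonLadder.lean @8334e482), CLEARED by decomp-fsc-crit-1-g0
2026-08-30T03:49:27Z; filing form (b): split ON the thin sibling RootDecompHorizonLadder where 26561
is top-level by signature · WEAKER (S ⟹ it; probes P1/P3/P5 not closed) · thin · IDEA-NEEDED +
INSTRUMENTABLE (census asks T-H1′/T-H2′: K4 comparable-mass Brill–Lindquist/Misner-type pairs beyond
the common-MOTS fold with ratio < 0.9 live here) · slicing-honesty caveat carried (NODE-g3.md §5(g))
· relieved BY THEOREM of the formation/dispersal alternative (outermost MOTS + non-compact Cauchy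
surface ⟹ null-incomplete MGHD [corpus:ashtekar2015 p.541])] SUBDOMINANT-HORIZON RESIDUAL: for every
Σ and every admissible datum d outside the four model cells (perturbative / near-extremal /
enclosed-core Kerr cells, Minkowski cell — the born residual guard R d) at which an APPARENT HORIZON
IS PRESENT in the born sense (AH d := the born «let Hor» body with its Penrose-ratio conjunct
dropped: a two-sided outermost MOTS in the born currency, floor rung p̄ = 0, kernel
hor_zero_iff_apparentHorizonB) but the born ho -/
@[route_item "route-FinalStateConjecture-RootDecompHorizonLadder"]
def SubdominantHorizonResidual : Prop :=
  ∀ (X : Type) [TopologicalSpace X] [ChartedSpace Literature.Geometry.Lorentzian.E3 X] [IsManifold (𝓡 3) ((⊤ : ℕ∞) : WithTop ℕ∞) X] [T2Space X] [SecondCountableTopology X] [ConnectedSpace X], let P : Literature.Geometry.Lorentzian.InitialDataSet (𝓡 3) X → Prop := fun D ↦ (∃ 𝒟 : Literature.Geometry.Lorentzian.VacuumCauchyDevelopment D, 𝒟.IsMaximal) ∧ ∀ 𝒟 : Literature.Geometry.Lorentzian.VacuumCauchyDevelopment D, 𝒟.IsMaximal → Summit.FinalStateConjecture.HasCompleteNullInfinity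 𝒟.toCauchyDevelopment ∧ ∃ (O : Set 𝒟.carrier) (d : Literature.Geometry.Lorentzian.FinalStateDecomposition 𝒟.toSpacetime O 2), (∀ i, Literature.Geometry.Lorentzian.Kerr.IsSubextremal (d.mass i) (d.spin i)) ∧ O = Summit.FinalStateConjecture.exteriorOf 𝒟.toCauchyDevelopment d.charted ∧ Summit.FinalStateConjecture.RaysStayInClosure 𝒟.toCauchyDevelopment O ∧ Summit.FinalStateConjecture.HasExhaustiveCharts d ∧ Summit.FinalStateConjecture.IsFutureOriented d; let K : Set (ℝ × ℝ) → Literature.Geometry.Lorentzian.InitialDataSet (𝓡 3) X → Prop := fun W D ↦ ∀ [Literature.Geometry.Lorentzian.Kerr.Facts] [Literature.Geometry.Lorentzian.Kerr.SliceFacts], ∃ (M a r₀ : ℝ) (hM : 0 < M), |a| < M ∧ (|a| / M, r₀ / M) ∈ W ∧ ∃ (θ : Literature.Geometry.Lorentzian.Kerr.slice a r₀ → X) (hθ : ContMDiff 𝓘(ℝ, Literature.Geometry.Lorentzian.E3) (𝓡 3) (((⊤ : ℕ∞) : WithTop ℕ∞) + 1) θ) (hθ' : ∀ u, Injective (mfderiv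 𝓘(ℝ, Literature.Geometry.Lorentzian.E3) (𝓡 3) θ u)), Topology.IsOpenEmbedding θ ∧ IsCompact (range θ)ᶜ ∧ (∀ s' : ℕ, Literature.Geometry.Lorentzian.InitialDataSet.dataWeightedSobolevEDist s' (-1 : ℝ) (D.comap θ hθ hθ') (Literature.Geometry.Lorentzian.Kerr.data M a r₀ hM.le) < ⊤) ∧ Literature.Geometry.Lorentzian.InitialDataSet.dataWeightedSobolevEDist 6 (-1 : ℝ) (D.comap θ hθ hθ') (Literature.Geometry.Lorentzian.Kerr.data M a r₀ hM.le) < ENNReal.ofReal 1; let Mink : Literature.Geometry.Lorentzian.InitialDataSet (𝓡 3) X → Prop := fun D ↦ ∃ (θ : Literature.Geometry.Lorentzian.Minkowski.slice → X) (hθ : ContMDiff 𝓘(ℝ, Literature.Geometry.Lorentzian.E3) (𝓡 3) (((⊤ : ℕ∞) : WithTop ℕ∞) + 1) θ) (hθ' : ∀ u, Injective (mfderiv 𝓘(ℝ, Literature.Geometry.Lorentzian.E3) (𝓡 3) θ u)), Topology.IsOpenEmbedding θ ∧ Surjective θ ∧ (∀ s' : ℕ, Literature.Geometry.Lorentzian.InitialDataSet.dataWeightedSobolevEDist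 s' (-1 : ℝ) (D.comap θ hθ hθ') Literature.Geometry.Lorentzian.trivialData < ⊤) ∧ Literature.Geometry.Lorentzian.InitialDataSet.dataWeightedSobolevEDist 6 (-1 : ℝ) (D.comap θ hθ hθ') Literature.Geometry.Lorentzian.trivialData < ENNReal.ofReal 1; let pert : Set (ℝ × ℝ) := {p | p.1 ≤ (9 / 10 : ℝ) ∧ 1 - Real.sqrt (1 - p.1 ^ 2) < p.2 ∧ p.2 < 1 + Real.sqrt (1 - p.1 ^ 2)}; let collar : Set (ℝ × ℝ) := {p | (9 / 10 : ℝ) < p.1 ∧ 1 - Real.sqrt (1 - p.1 ^ 2) < p.2 ∧ p.2 < 1 + Real.sqrt (1 - p.1 ^ 2)}; let shell : Set (ℝ × ℝ) := {p | 1 + Real.sqrt (1 - p.1 ^ 2) ≤ p.2 ∧ p.2 ≤ 3}; let Hor : Literature.Geometry.Lorentzian.InitialDataSet (𝓡 3) X → Prop := fun D ↦ ∃ (hLC : D.metric.HasLeviCivita) (e : Literature.Geometry.Lorentzian.AFEnd X) (S : Literature.Geometry.Lorentzian.OutermostMOTS (𝓡 3) D.h D.k), haveI : (Literature.Geometry.Lorentzian.PseudoRiemannianMetric.ofRiemannian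 D.h).HasLeviCivita := hLC; let IsExteriorRegion : TopologicalSpace.Opens X → Prop := fun U ↦ IsConnected (U : Set X) ∧ ∃ R', e.R < R' ∧ e.far R' ⊆ (U : Set X) ∧ IsCompact (closure (U : Set X) \ e.far R'); let IsOutsideOf : TopologicalSpace.Opens X → (S' : Type) → (f' : S' → X) → Literature.Geometry.Lorentzian.NormalField (𝓡 3) f' → Prop := fun U _ f' ν' ↦ frontier (U : Set X) = Set.range f' ∧ (∀ y, ∀ᶠ t in nhdsWithin (0 : ℝ) (Set.Ioi 0), Literature.Geometry.Lorentzian.curveThrough (𝓡 3) (f' y) (ν' y) t ∈ (U : Set X)) ∧ (∀ y, ∀ᶠ t in nhdsWithin (0 : ℝ) (Set.Iio 0), Literature.Geometry.Lorentzian.curveThrough (𝓡 3) (f' y) (ν' y) t ∉ closure (U : Set X)) ∧ IsExteriorRegion U; let IsCalS : TopologicalSpace.Opens X → Prop := fun V ↦ ∃ (S' : Type) (_ : TopologicalSpace S') (_ : ChartedSpace (EuclideanSpace ℝ (Fin 2)) S') (_ : IsManifold (𝓡 2) ((⊤ : ℕ∞) : WithTop ℕ∞) S') (_ : CompactSpace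 S') (_ : T2Space S') (f' : S' → X) (ν' : Literature.Geometry.Lorentzian.NormalField (𝓡 3) f'), Manifold.IsSmoothEmbedding (𝓡 2) (𝓡 3) ((⊤ : ℕ∞) : WithTop ℕ∞) f' ∧ (Literature.Geometry.Lorentzian.PseudoRiemannianMetric.ofRiemannian D.h).IsUnitNormal (𝓡 2) f' ν' 1 ∧ IsOutsideOf V S' f' ν'; let WOTFree : TopologicalSpace.Opens X → Prop := fun U ↦ ∀ (S' : Type) [TopologicalSpace S'] [ChartedSpace (EuclideanSpace ℝ (Fin 2)) S'] [IsManifold (𝓡 2) ((⊤ : ℕ∞) : WithTop ℕ∞) S'] [CompactSpace S'] [T2Space S'] (f' : S' → X) (ν' : Literature.Geometry.Lorentzian.NormalField (𝓡 3) f') (hpb' : Literature.Geometry.Lorentzian.PseudoRiemannianMetric.contMDiff_pullbackBilin (𝓡 3) X (𝓡 2) S' ((⊤ : ℕ∞) : WithTop ℕ∞)) (hf' : (Literature.Geometry.Lorentzian.PseudoRiemannianMetric.ofRiemannian D.h).IsSpacelikeImmersion (𝓡 2) f') (Ω : TopologicalSpace.Opens X), Manifold.IsSmoothEmbedding (𝓡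 2) (𝓡 3) ((⊤ : ℕ∞) : WithTop ℕ∞) f' → Set.range f' ⊆ (U : Set X) → (Literature.Geometry.Lorentzian.PseudoRiemannianMetric.ofRiemannian D.h).IsUnitNormal (𝓡 2) f' ν' 1 → Nonempty S' → frontier (Ω : Set X) = Set.range f' → (∃ R', e.R < R' ∧ Disjoint (e.far R') (Ω : Set X)) → (∀ y, ∀ᶠ t in nhdsWithin (0 : ℝ) (Set.Iio 0), Literature.Geometry.Lorentzian.curveThrough (𝓡 3) (f' y) (ν' y) t ∈ (Ω : Set X)) → ¬ Literature.Geometry.Lorentzian.IsWeaklyOuterTrapped D.h D.k f' hpb' hf' ν'; ContMDiff (𝓡 2) (𝓡 3).tangent ((⊤ : ℕ∞) : WithTop ℕ∞) (fun y ↦ (Bundle.TotalSpace.mk' Literature.Geometry.Lorentzian.E3 (S.f y) (S.ν y) : TangentBundle (𝓡 3) X)) ∧ D.SatisfiesDominantEnergyCondition ∧ e.IsAsymptoticallyFlat D 1 ∧ D.IsComplete ∧ (∃ m, e.HasADMEnergy D m) ∧ (∀ i, ∃ p, e.HasADMMomentum D i p) ∧ WOTFree S.exterior ∧ IsOutsideOf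 S.exterior S.surf S.f S.ν ∧ 0 < e.admMass D ∧ (letI : MeasurableSpace X := borel X; haveI : BorelSpace X := ⟨rfl⟩; haveI : LocallyCompactSpace X := ChartedSpace.locallyCompactSpace Literature.Geometry.Lorentzian.E3 X; (9 / 10 : ℝ) * e.admMass D ≤ Real.sqrt ((⨅ (V : TopologicalSpace.Opens X) (_ : IsCalS V ∧ V ≤ S.exterior), Literature.Geometry.Lorentzian.area D.h (frontier (V : Set X))).toReal / (16 * Real.pi))); let AH : Literature.Geometry.Lorentzian.InitialDataSet (𝓡 3) X → Prop := fun D ↦ ∃ (hLC : D.metric.HasLeviCivita) (e : Literature.Geometry.Lorentzian.AFEnd X) (S : Literature.Geometry.Lorentzian.OutermostMOTS (𝓡 3) D.h D.k), haveI : (Literature.Geometry.Lorentzian.PseudoRiemannianMetric.ofRiemannian D.h).HasLeviCivita := hLC; let IsExteriorRegion : TopologicalSpace.Opens X → Prop := fun U ↦ IsConnected (U : Set X) ∧ ∃ R', e.R < R' ∧ e.far R' ⊆ (U : Set X) ∧ IsCompact (closure (U : Set X) \ e.far R'); let IsOutsideOf : TopologicalSpace.Opens X → (S' : Type) → (f'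 : S' → X) → Literature.Geometry.Lorentzian.NormalField (𝓡 3) f' → Prop := fun U _ f' ν' ↦ frontier (U : Set X) = Set.range f' ∧ (∀ y, ∀ᶠ t in nhdsWithin (0 : ℝ) (Set.Ioi 0), Literature.Geometry.Lorentzian.curveThrough (𝓡 3) (f' y) (ν' y) t ∈ (U : Set X)) ∧ (∀ y, ∀ᶠ t in nhdsWithin (0 : ℝ) (Set.Iio 0), Literature.Geometry.Lorentzian.curveThrough (𝓡 3) (f' y) (ν' y) t ∉ closure (U : Set X)) ∧ IsExteriorRegion U; let WOTFree : TopologicalSpace.Opens X → Prop := fun U ↦ ∀ (S' : Type) [TopologicalSpace S'] [ChartedSpace (EuclideanSpace ℝ (Fin 2)) S'] [IsManifold (𝓡 2) ((⊤ : ℕ∞) : WithTop ℕ∞) S'] [CompactSpace S'] [T2Space S'] (f' : S' → X) (ν' : Literature.Geometry.Lorentzian.NormalField (𝓡 3) f') (hpb' : Literature.Geometry.Lorentzian.PseudoRiemannianMetric.contMDiff_pullbackBilin (𝓡 3) X (𝓡 2) S' ((⊤ : ℕ∞) : WithTop ℕ∞)) (hf' : (Literature.Geometry.Lorentzian.PseudoRiemannianMetric.ofRiemannian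 D.h).IsSpacelikeImmersion (𝓡 2) f') (Ω : TopologicalSpace.Opens X), Manifold.IsSmoothEmbedding (𝓡 2) (𝓡 3) ((⊤ : ℕ∞) : WithTop ℕ∞) f' → Set.range f' ⊆ (U : Set X) → (Literature.Geometry.Lorentzian.PseudoRiemannianMetric.ofRiemannian D.h).IsUnitNormal (𝓡 2) f' ν' 1 → Nonempty S' → frontier (Ω : Set X) = Set.range f' → (∃ R', e.R < R' ∧ Disjoint (e.far R') (Ω : Set X)) → (∀ y, ∀ᶠ t in nhdsWithin (0 : ℝ) (Set.Iio 0), Literature.Geometry.Lorentzian.curveThrough (𝓡 3) (f' y) (ν' y) t ∈ (Ω : Set X)) → ¬ Literature.Geometry.Lorentzian.IsWeaklyOuterTrapped D.h D.k f' hpb' hf' ν'; ContMDiff (𝓡 2) (𝓡 3).tangent ((⊤ : ℕ∞) : WithTop ℕ∞) (fun y ↦ (Bundle.TotalSpace.mk' Literature.Geometry.Lorentzian.E3 (S.f y) (S.ν y) : TangentBundle (𝓡 3) X)) ∧ D.SatisfiesDominantEnergyCondition ∧ e.IsAsymptoticallyFlat D 1 ∧ D.IsComplete ∧ (∃ m,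 e.HasADMEnergy D m) ∧ (∀ i, ∃ p, e.HasADMMomentum D i p) ∧ WOTFree S.exterior ∧ IsOutsideOf S.exterior S.surf S.f S.ν ∧ 0 < e.admMass D; ∀ d ∈ Literature.Geometry.Lorentzian.admissibleVacuumData X, ¬ P d → (¬ K pert d ∧ ¬ K collar d ∧ ¬ K shell d ∧ ¬ Mink d) → AH d → ¬ Hor d → ∃ (e : Literature.Geometry.Lorentzian.AFEnd X) (F : EuclideanSpace ℝ (Fin 1) → Literature.Geometry.Lorentzian.InitialDataSet (𝓡 3) X), Literature.Geometry.Lorentzian.InitialDataSet.IsTameDataFamily e 1 F ∧ Literature.Geometry.Lorentzian.InitialDataSet.IsImmersedAtZero 1 F ∧ F 0 = d ∧ Injective F ∧ (∀ c, F c ∈ Literature.Geometry.Lorentzian.admissibleVacuumData X) ∧ ∀ c ≠ 0, P (F c)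

-- parent: SubPenroseResidual · child (gen 1)
/--     item stmt-FinalStateConjecture-27212 · crux · rank 402 · open
    parent: SubPenroseResidual · by planner
    why it might fail: horizon-free large data carry the whole formation-vs-dispersal dichotomy: no theorem decides, for generic large AH-free vacuum data, between trapped-surface formation and dispersion, and an open set could do neither tamely (e.g. long-lived near-critical dynamics).
    sources: arXiv:0805.3880, arXiv:1409.6270, arXiv:1302.5951, Christodoulou1999, arXiv:gr-qc/9910040
[crux · gen-3 glued split of SubPenroseResidual (stmt-26561), lens-1 g3 node «HorizonLadder v2»,
CLEARED by decomp-fsc-crit-1-g0 2026-08-30T03:49:27Z; filing form (b) · WEAKER · NEW RESIDUAL ·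
INTERNAL NODE (gen ≥ 4) · IDEA-NEEDED — carries the trapped-surface FORMATION mechanism
(Christodoulou 0805.3880 / An–Luk / Klainerman–Luk–Rodnianski / Li–Yu [corpus:ashtekar2015
p.588–590]) absent from its sibling; PARK RULE (critic 03:28:43Z) applies to its next cut: it may be
split again only by an attackable norm-matched rung or a thin piece with a registered kill path,
else it is parked as typed; candidate gen-4 cuts named by the lens: Schoen–Yau concentration scale /
short-pulse cell] HORIZON-FREE RESIDUAL: for every Σ and every admissible datum d outside the four
model cells at which NO apparent horizon is present in the born sense (¬AH d), if d fails the cure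
target P_Σ then a tame 1-parameter admissible line through d carries P off c = 0 (the born exit,
verbatim). One-liner = tree text of 26561 with the unused «let Hor» replaced by «let AH»; guard «R d
→ ¬ AH d →». Exactness: 26561 ⟺ SubdominantHorizonResidual ∧ HorizonFreeResidual (free split by
excluded middle on AH d; lens kernel -/
@[route_item "route-FinalStateConjecture-RootDecompHorizonLadder"]
def HorizonFreeResidual : Prop :=
  ∀ (X : Type) [TopologicalSpace X] [ChartedSpace Literature.Geometry.Lorentzian.E3 X] [IsManifold (𝓡 3) ((⊤ : ℕ∞) : WithTop ℕ∞) X] [T2Space X] [SecondCountableTopology X] [ConnectedSpace X], let P : Literature.Geometry.Lorentzian.InitialDataSet (𝓡 3) X → Prop := fun D ↦ (∃ 𝒟 : Literature.Geometry.Lorentzian.VacuumCauchyDevelopment D, 𝒟.IsMaximal) ∧ ∀ 𝒟 : Literature.Geometry.Lorentzian.VacuumCauchyDevelopment D, 𝒟.IsMaximal → Summit.FinalStateConjecture.HasCompleteNullInfinity 𝒟.toCauchyDevelopment ∧ ∃ (O : Set 𝒟.carrier) (d : Literature.Geometry.Lorentzian.FinalStateDecomposition 𝒟.toSpacetime O 2),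 (∀ i, Literature.Geometry.Lorentzian.Kerr.IsSubextremal (d.mass i) (d.spin i)) ∧ O = Summit.FinalStateConjecture.exteriorOf 𝒟.toCauchyDevelopment d.charted ∧ Summit.FinalStateConjecture.RaysStayInClosure 𝒟.toCauchyDevelopment O ∧ Summit.FinalStateConjecture.HasExhaustiveCharts d ∧ Summit.FinalStateConjecture.IsFutureOriented d; let K : Set (ℝ × ℝ) → Literature.Geometry.Lorentzian.InitialDataSet (𝓡 3) X → Prop := fun W D ↦ ∀ [Literature.Geometry.Lorentzian.Kerr.Facts] [Literature.Geometry.Lorentzian.Kerr.SliceFacts], ∃ (M a r₀ : ℝ) (hM : 0 < M), |a| < M ∧ (|a| / M, r₀ / M) ∈ W ∧ ∃ (θ : Literature.Geometry.Lorentzian.Kerr.slice a r₀ → X) (hθ : ContMDiff 𝓘(ℝ, Literature.Geometry.Lorentzian.E3) (𝓡 3) (((⊤ : ℕ∞) : WithTop ℕ∞) + 1) θ) (hθ' : ∀ u, Injective (mfderiv 𝓘(ℝ, Literature.Geometry.Lorentzian.E3) (𝓡 3) θ u)), Topology.IsOpenEmbedding θ ∧ IsCompact (range θ)ᶜ ∧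 (∀ s' : ℕ, Literature.Geometry.Lorentzian.InitialDataSet.dataWeightedSobolevEDist s' (-1 : ℝ) (D.comap θ hθ hθ') (Literature.Geometry.Lorentzian.Kerr.data M a r₀ hM.le) < ⊤) ∧ Literature.Geometry.Lorentzian.InitialDataSet.dataWeightedSobolevEDist 6 (-1 : ℝ) (D.comap θ hθ hθ') (Literature.Geometry.Lorentzian.Kerr.data M a r₀ hM.le) < ENNReal.ofReal 1; let Mink : Literature.Geometry.Lorentzian.InitialDataSet (𝓡 3) X → Prop := fun D ↦ ∃ (θ : Literature.Geometry.Lorentzian.Minkowski.slice → X) (hθ : ContMDiff 𝓘(ℝ, Literature.Geometry.Lorentzian.E3) (𝓡 3) (((⊤ : ℕ∞) : WithTop ℕ∞) + 1) θ) (hθ' : ∀ u, Injective (mfderiv 𝓘(ℝ, Literature.Geometry.Lorentzian.E3) (𝓡 3) θ u)), Topology.IsOpenEmbedding θ ∧ Surjective θ ∧ (∀ s' : ℕ, Literature.Geometry.Lorentzian.InitialDataSet.dataWeightedSobolevEDist s' (-1 : ℝ) (D.comap θ hθ hθ') Literature.Geometry.Lorentzian.trivialData < ⊤) ∧ Literature.Geometry.Lorentzian.InitialDataSet.dataWeightedSobolevEDist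 6 (-1 : ℝ) (D.comap θ hθ hθ') Literature.Geometry.Lorentzian.trivialData < ENNReal.ofReal 1; let pert : Set (ℝ × ℝ) := {p | p.1 ≤ (9 / 10 : ℝ) ∧ 1 - Real.sqrt (1 - p.1 ^ 2) < p.2 ∧ p.2 < 1 + Real.sqrt (1 - p.1 ^ 2)}; let collar : Set (ℝ × ℝ) := {p | (9 / 10 : ℝ) < p.1 ∧ 1 - Real.sqrt (1 - p.1 ^ 2) < p.2 ∧ p.2 < 1 + Real.sqrt (1 - p.1 ^ 2)}; let shell : Set (ℝ × ℝ) := {p | 1 + Real.sqrt (1 - p.1 ^ 2) ≤ p.2 ∧ p.2 ≤ 3}; let AH : Literature.Geometry.Lorentzian.InitialDataSet (𝓡 3) X → Prop := fun D ↦ ∃ (hLC : D.metric.HasLeviCivita) (e : Literature.Geometry.Lorentzian.AFEnd X) (S : Literature.Geometry.Lorentzian.OutermostMOTS (𝓡 3) D.h D.k), haveI : (Literature.Geometry.Lorentzian.PseudoRiemannianMetric.ofRiemannian D.h).HasLeviCivita := hLC; let IsExteriorRegion : TopologicalSpace.Opens X → Prop := fun U ↦ IsConnected (U : Set X) ∧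 ∃ R', e.R < R' ∧ e.far R' ⊆ (U : Set X) ∧ IsCompact (closure (U : Set X) \ e.far R'); let IsOutsideOf : TopologicalSpace.Opens X → (S' : Type) → (f' : S' → X) → Literature.Geometry.Lorentzian.NormalField (𝓡 3) f' → Prop := fun U _ f' ν' ↦ frontier (U : Set X) = Set.range f' ∧ (∀ y, ∀ᶠ t in nhdsWithin (0 : ℝ) (Set.Ioi 0), Literature.Geometry.Lorentzian.curveThrough (𝓡 3) (f' y) (ν' y) t ∈ (U : Set X)) ∧ (∀ y, ∀ᶠ t in nhdsWithin (0 : ℝ) (Set.Iio 0), Literature.Geometry.Lorentzian.curveThrough (𝓡 3) (f' y) (ν' y) t ∉ closure (U : Set X)) ∧ IsExteriorRegion U; let WOTFree : TopologicalSpace.Opens X → Prop := fun U ↦ ∀ (S' : Type) [TopologicalSpace S'] [ChartedSpace (EuclideanSpace ℝ (Fin 2)) S'] [IsManifold (𝓡 2) ((⊤ : ℕ∞) : WithTop ℕ∞) S'] [CompactSpace S'] [T2Space S'] (f' : S' → X) (ν' : Literature.Geometry.Lorentzian.NormalField (𝓡 3) f') (hpb' : Literature.Geometry.Lorentzian.PseudoRiemannianMetric.contMDiff_pullbackBilin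 (𝓡 3) X (𝓡 2) S' ((⊤ : ℕ∞) : WithTop ℕ∞)) (hf' : (Literature.Geometry.Lorentzian.PseudoRiemannianMetric.ofRiemannian D.h).IsSpacelikeImmersion (𝓡 2) f') (Ω : TopologicalSpace.Opens X), Manifold.IsSmoothEmbedding (𝓡 2) (𝓡 3) ((⊤ : ℕ∞) : WithTop ℕ∞) f' → Set.range f' ⊆ (U : Set X) → (Literature.Geometry.Lorentzian.PseudoRiemannianMetric.ofRiemannian D.h).IsUnitNormal (𝓡 2) f' ν' 1 → Nonempty S' → frontier (Ω : Set X) = Set.range f' → (∃ R', e.R < R' ∧ Disjoint (e.far R') (Ω : Set X)) → (∀ y, ∀ᶠ t in nhdsWithin (0 : ℝ) (Set.Iio 0), Literature.Geometry.Lorentzian.curveThrough (𝓡 3) (f' y) (ν' y) t ∈ (Ω : Set X)) → ¬ Literature.Geometry.Lorentzian.IsWeaklyOuterTrapped D.h D.k f' hpb' hf' ν'; ContMDiff (𝓡 2) (𝓡 3).tangent ((⊤ : ℕ∞) : WithTop ℕ∞) (fun y ↦ (Bundle.TotalSpace.mk' Literature.Geometry.Lorentzian.E3 (S.f y) (S.ν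 y) : TangentBundle (𝓡 3) X)) ∧ D.SatisfiesDominantEnergyCondition ∧ e.IsAsymptoticallyFlat D 1 ∧ D.IsComplete ∧ (∃ m, e.HasADMEnergy D m) ∧ (∀ i, ∃ p, e.HasADMMomentum D i p) ∧ WOTFree S.exterior ∧ IsOutsideOf S.exterior S.surf S.f S.ν ∧ 0 < e.admMass D; ∀ d ∈ Literature.Geometry.Lorentzian.admissibleVacuumData X, ¬ P d → (¬ K pert d ∧ ¬ K collar d ∧ ¬ K shell d ∧ ¬ Mink d) → ¬ AH d → ∃ (e : Literature.Geometry.Lorentzian.AFEnd X) (F : EuclideanSpace ℝ (Fin 1) → Literature.Geometry.Lorentzian.InitialDataSet (𝓡 3) X), Literature.Geometry.Lorentzian.InitialDataSet.IsTameDataFamily e 1 F ∧ Literature.Geometry.Lorentzian.InitialDataSet.IsImmersedAtZero 1 F ∧ F 0 = d ∧ Injective F ∧ (∀ c, F c ∈ Literature.Geometry.Lorentzian.admissibleVacuumData X) ∧ ∀ c ≠ 0, P (F c)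

-- parent: SubPenroseResidual · glue (gen 1)
/--     item stmt-FinalStateConjecture-27213 · support · rank 403 · closed · proved by Summit.FinalStateConjecture.FinalStateConjecture.Theorems.RootDecompHorizonLadder.subPenroseResidualGlue_proof (prover)
    parent: SubPenroseResidual · GLUE: children ⟹ parent · by planner
SubdominantHorizonResidual → HorizonFreeResidual → SubPenroseResidual -/
@[route_item "route-FinalStateConjecture-RootDecompHorizonLadder"]
def SubPenroseResidualGlue : Prop :=
  SubdominantHorizonResidual → HorizonFreeResidual → SubPenroseResidual

-- `SubPenroseResidualGlue` holds: proved by `Summit.FinalStateConjecture.FinalStateConjecture.Theorems.RootDecompHorizonLadder.subPenroseResidualGlue_proof` (its module imports this route file, so no `_holds` link can be stated here).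

/-- item stmt-FinalStateConjecture-26560 · crux · rank 5 · SPLIT (gen 1) into ScaledModelCapture, TimeSymmetricPenroseCeiling, DynamicalPenroseCeiling, GenuineHorizonDominated + glue HorizonDominatedResidualGlue · direct attempts still welcome (low priority) · by planner
why it might fail: Near-saturating apparent horizons do not control the exterior in the H^s norms Kerr stability consumes (Lee–Sormani, Allen, Dong: weak norms only); a laminated capture threshold inside 𝓗(9/10) (comparable spectators just under the 10 % budget) would defeat tame exits.
sources: arXiv:1109.2165, arXiv:1705.00591, doi:10.2140/gt.2025.29.4911, arXiv:2304.08455, Christodoulou1999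
[crux · gen-2 glued split of ExtendedFieldResidual (stmt-25091), lens-1 g2 node HorizonSplit,
CLEARED[+follow-ups F1–F3] by decomp-fsc-crit-1-g0 2026-08-30T02:58:30Z; child A = S-exit on R ∩
𝓗(9/10): the residual data (unit-far from every model tube of the born tuple (6,−1,1,9/10,3,1))
whose slice carries an outermost MOTS S bounding the sole end's exterior, WOT-free outside, m_ADM >
0 and ENCLOSURE Penrose ratio √(A_min(S)/16π) ≥ (9/10)·m_ADM; RESIDUAL-relieved · WEAKER (kernel
horizonDominatedResidualAt_of_summit, split_iff; probes A → S / A → parent fail) · COUNTS-candidate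
→ COUNTS once F1 (kernel Hor_core_iff_of_admissible on admissible data) lands (critic 03:16:15Z: F2
inhabitant SATISFIED at print level — late slices of one-ended collapse radiating < 19 %; F3: the p̄
= 1, k = 0 stratum is DECORATIVE-true either way and is NOT a rung of this piece) ·
IDEA-NEEDED[U_rate] (caution c4 F8 topology mismatch applies to any porting reading) (no theorem
evolves large vacuum data containing a MOTS to a settled exterior; near-equality Penrose rigidity
controls the exterior only weakly) · INSTRUMENTABLE (census T-H1–T-H3); ceiling p̄ > 1 EMPTY under
the corrected enclosure Penrose inequ -/
@[route_item "route-FinalStateConjecture-RootDecompHorizonLadder", crux]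
def HorizonDominatedResidual : Prop :=
  ∀ (X : Type) [TopologicalSpace X] [ChartedSpace Literature.Geometry.Lorentzian.E3 X] [IsManifold (𝓡 3) ((⊤ : ℕ∞) : WithTop ℕ∞) X] [T2Space X] [SecondCountableTopology X] [ConnectedSpace X], let P : Literature.Geometry.Lorentzian.InitialDataSet (𝓡 3) X → Prop := fun D ↦ (∃ 𝒟 : Literature.Geometry.Lorentzian.VacuumCauchyDevelopment D, 𝒟.IsMaximal) ∧ ∀ 𝒟 : Literature.Geometry.Lorentzian.VacuumCauchyDevelopment D, 𝒟.IsMaximal → Summit.FinalStateConjecture.HasCompleteNullInfinity 𝒟.toCauchyDevelopment ∧ ∃ (O : Set 𝒟.carrier) (d : Literature.Geometry.Lorentzian.FinalStateDecomposition 𝒟.toSpacetime O 2), (∀ i, Literature.Geometry.Lorentzian.Kerr.IsSubextremal (d.mass i) (d.spin i)) ∧ O = Summit.FinalStateConjecture.exteriorOf 𝒟.toCauchyDevelopment d.charted ∧ Summit.FinalStateConjecture.RaysStayInClosure 𝒟.toCauchyDevelopment O ∧ Summit.FinalStateConjecture.HasExhaustiveCharts d ∧ Summit.FinalStateConjecture.IsFutureOriented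 d; let K : Set (ℝ × ℝ) → Literature.Geometry.Lorentzian.InitialDataSet (𝓡 3) X → Prop := fun W D ↦ ∀ [Literature.Geometry.Lorentzian.Kerr.Facts] [Literature.Geometry.Lorentzian.Kerr.SliceFacts], ∃ (M a r₀ : ℝ) (hM : 0 < M), |a| < M ∧ (|a| / M, r₀ / M) ∈ W ∧ ∃ (θ : Literature.Geometry.Lorentzian.Kerr.slice a r₀ → X) (hθ : ContMDiff 𝓘(ℝ, Literature.Geometry.Lorentzian.E3) (𝓡 3) (((⊤ : ℕ∞) : WithTop ℕ∞) + 1) θ) (hθ' : ∀ u, Injective (mfderiv 𝓘(ℝ, Literature.Geometry.Lorentzian.E3) (𝓡 3) θ u)), Topology.IsOpenEmbedding θ ∧ IsCompact (range θ)ᶜ ∧ (∀ s' : ℕ, Literature.Geometry.Lorentzian.InitialDataSet.dataWeightedSobolevEDist s' (-1 : ℝ) (D.comap θ hθ hθ') (Literature.Geometry.Lorentzian.Kerr.data M a r₀ hM.le) < ⊤) ∧ Literature.Geometry.Lorentzian.InitialDataSet.dataWeightedSobolevEDist 6 (-1 : ℝ) (D.comap θ hθ hθ') (Literature.Geometry.Lorentzian.Kerr.data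 M a r₀ hM.le) < ENNReal.ofReal 1; let Mink : Literature.Geometry.Lorentzian.InitialDataSet (𝓡 3) X → Prop := fun D ↦ ∃ (θ : Literature.Geometry.Lorentzian.Minkowski.slice → X) (hθ : ContMDiff 𝓘(ℝ, Literature.Geometry.Lorentzian.E3) (𝓡 3) (((⊤ : ℕ∞) : WithTop ℕ∞) + 1) θ) (hθ' : ∀ u, Injective (mfderiv 𝓘(ℝ, Literature.Geometry.Lorentzian.E3) (𝓡 3) θ u)), Topology.IsOpenEmbedding θ ∧ Surjective θ ∧ (∀ s' : ℕ, Literature.Geometry.Lorentzian.InitialDataSet.dataWeightedSobolevEDist s' (-1 : ℝ) (D.comap θ hθ hθ') Literature.Geometry.Lorentzian.trivialData < ⊤) ∧ Literature.Geometry.Lorentzian.InitialDataSet.dataWeightedSobolevEDist 6 (-1 : ℝ) (D.comap θ hθ hθ') Literature.Geometry.Lorentzian.trivialData < ENNReal.ofReal 1; let pert : Set (ℝ × ℝ) := {p | p.1 ≤ (9 / 10 : ℝ) ∧ 1 - Real.sqrt (1 - p.1 ^ 2) < p.2 ∧ p.2 < 1 + Real.sqrt (1 - p.1 ^ 2)};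 let collar : Set (ℝ × ℝ) := {p | (9 / 10 : ℝ) < p.1 ∧ 1 - Real.sqrt (1 - p.1 ^ 2) < p.2 ∧ p.2 < 1 + Real.sqrt (1 - p.1 ^ 2)}; let shell : Set (ℝ × ℝ) := {p | 1 + Real.sqrt (1 - p.1 ^ 2) ≤ p.2 ∧ p.2 ≤ 3}; let Hor : Literature.Geometry.Lorentzian.InitialDataSet (𝓡 3) X → Prop := fun D ↦ ∃ (hLC : D.metric.HasLeviCivita) (e : Literature.Geometry.Lorentzian.AFEnd X) (S : Literature.Geometry.Lorentzian.OutermostMOTS (𝓡 3) D.h D.k), haveI : (Literature.Geometry.Lorentzian.PseudoRiemannianMetric.ofRiemannian D.h).HasLeviCivita := hLC; let IsExteriorRegion : TopologicalSpace.Opens X → Prop := fun U ↦ IsConnected (U : Set X) ∧ ∃ R', e.R < R' ∧ e.far R' ⊆ (U : Set X) ∧ IsCompact (closure (U : Set X) \ e.far R'); let IsOutsideOf : TopologicalSpace.Opens X → (S' : Type) → (f' : S' → X) → Literature.Geometry.Lorentzian.NormalField (𝓡 3) f' → Prop := fun U _ f' ν' ↦ frontier (U : Set X) = Set.range f' ∧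 (∀ y, ∀ᶠ t in nhdsWithin (0 : ℝ) (Set.Ioi 0), Literature.Geometry.Lorentzian.curveThrough (𝓡 3) (f' y) (ν' y) t ∈ (U : Set X)) ∧ (∀ y, ∀ᶠ t in nhdsWithin (0 : ℝ) (Set.Iio 0), Literature.Geometry.Lorentzian.curveThrough (𝓡 3) (f' y) (ν' y) t ∉ closure (U : Set X)) ∧ IsExteriorRegion U; let IsCalS : TopologicalSpace.Opens X → Prop := fun V ↦ ∃ (S' : Type) (_ : TopologicalSpace S') (_ : ChartedSpace (EuclideanSpace ℝ (Fin 2)) S') (_ : IsManifold (𝓡 2) ((⊤ : ℕ∞) : WithTop ℕ∞) S') (_ : CompactSpace S') (_ : T2Space S') (f' : S' → X) (ν' : Literature.Geometry.Lorentzian.NormalField (𝓡 3) f'), Manifold.IsSmoothEmbedding (𝓡 2) (𝓡 3) ((⊤ : ℕ∞) : WithTop ℕ∞) f' ∧ (Literature.Geometry.Lorentzian.PseudoRiemannianMetric.ofRiemannian D.h).IsUnitNormal (𝓡 2) f' ν' 1 ∧ IsOutsideOf V S' f' ν'; let WOTFree : TopologicalSpace.Opens X → Prop := fun U ↦ ∀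 (S' : Type) [TopologicalSpace S'] [ChartedSpace (EuclideanSpace ℝ (Fin 2)) S'] [IsManifold (𝓡 2) ((⊤ : ℕ∞) : WithTop ℕ∞) S'] [CompactSpace S'] [T2Space S'] (f' : S' → X) (ν' : Literature.Geometry.Lorentzian.NormalField (𝓡 3) f') (hpb' : Literature.Geometry.Lorentzian.PseudoRiemannianMetric.contMDiff_pullbackBilin (𝓡 3) X (𝓡 2) S' ((⊤ : ℕ∞) : WithTop ℕ∞)) (hf' : (Literature.Geometry.Lorentzian.PseudoRiemannianMetric.ofRiemannian D.h).IsSpacelikeImmersion (𝓡 2) f') (Ω : TopologicalSpace.Opens X), Manifold.IsSmoothEmbedding (𝓡 2) (𝓡 3) ((⊤ : ℕ∞) : WithTop ℕ∞) f' → Set.range f' ⊆ (U : Set X) → (Literature.Geometry.Lorentzian.PseudoRiemannianMetric.ofRiemannian D.h).IsUnitNormal (𝓡 2) f' ν' 1 → Nonempty S' → frontier (Ω : Set X) = Set.range f' → (∃ R', e.R < R' ∧ Disjoint (e.far R') (Ω : Set X)) → (∀ y, ∀ᶠ t in nhdsWithin (0 : ℝ) (Set.Iio 0), Literature.Geometry.Lorentzian.curveThrough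 (𝓡 3) (f' y) (ν' y) t ∈ (Ω : Set X)) → ¬ Literature.Geometry.Lorentzian.IsWeaklyOuterTrapped D.h D.k f' hpb' hf' ν'; ContMDiff (𝓡 2) (𝓡 3).tangent ((⊤ : ℕ∞) : WithTop ℕ∞) (fun y ↦ (Bundle.TotalSpace.mk' Literature.Geometry.Lorentzian.E3 (S.f y) (S.ν y) : TangentBundle (𝓡 3) X)) ∧ D.SatisfiesDominantEnergyCondition ∧ e.IsAsymptoticallyFlat D 1 ∧ D.IsComplete ∧ (∃ m, e.HasADMEnergy D m) ∧ (∀ i, ∃ p, e.HasADMMomentum D i p) ∧ WOTFree S.exterior ∧ IsOutsideOf S.exterior S.surf S.f S.ν ∧ 0 < e.admMass D ∧ (letI : MeasurableSpace X := borel X; haveI : BorelSpace X := ⟨rfl⟩; haveI : LocallyCompactSpace X := ChartedSpace.locallyCompactSpace Literature.Geometry.Lorentzian.E3 X; (9 / 10 : ℝ) * e.admMass D ≤ Real.sqrt ((⨅ (V : TopologicalSpace.Opens X) (_ : IsCalS V ∧ V ≤ S.exterior), Literature.Geometry.Lorentzian.area D.h (frontier (V : Set X))).toReal / (16 * Real.pi)));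 ∀ d ∈ Literature.Geometry.Lorentzian.admissibleVacuumData X, ¬ P d → (¬ K pert d ∧ ¬ K collar d ∧ ¬ K shell d ∧ ¬ Mink d) → Hor d → ∃ (e : Literature.Geometry.Lorentzian.AFEnd X) (F : EuclideanSpace ℝ (Fin 1) → Literature.Geometry.Lorentzian.InitialDataSet (𝓡 3) X), Literature.Geometry.Lorentzian.InitialDataSet.IsTameDataFamily e 1 F ∧ Literature.Geometry.Lorentzian.InitialDataSet.IsImmersedAtZero 1 F ∧ F 0 = d ∧ Injective F ∧ (∀ c, F c ∈ Literature.Geometry.Lorentzian.admissibleVacuumData X) ∧ ∀ c ≠ 0, P (F c)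

-- parent: HorizonDominatedResidual · child (gen 1)
/--     item stmt-FinalStateConjecture-29336 · crux · rank 502 · open
    parent: HorizonDominatedResidual · by planner
    why it might fail: only the port can fail: the born outermost notion (no weakly outer trapped EMBEDDED surface in the exterior) must give Huisken–Ilmanen's printed condition over IMMERSED minimal images, and the tree's set-area `area h (frontier V)` must be identified with `S.surfaceArea` (area formula absent)
    sources: BrayRPI2001, HuiskenIlmanenIMCF2001, doi:10.1017/cbo9781139583961
[crux · THIN · SPECIAL-TYPE (k ≡ 0) · EMPTY-BY-PRINTED-THEOREM (Bray 2001 Thm 19 + Huisken–Ilmanen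
Lemma 4.1; tree facts riemannian_penrose_inequality_outermost /
Bray2001_penrose_inequality_exteriorRegion, OutermostHorizon.lean) modulo port chain P1–P6 (genuine
lemmas: P3 embedded-WOT-free ⇒ immersed-minimal-free, P5 set-area = induced area) · does NOT count ·
ATTACKABLE NOW, closing shape «(h : riemannian_penrose_inequality_outermost) →
TimeSymmetricPenroseCeiling» (fact-conditional) · critic CLEARED 2026-08-30T06:16:02Z row 66] [crux
· gen-5 cut of HorizonDominatedResidual (stmt-FinalStateConjecture-26560), lens-1 g5 node
PenroseSaturation · guards ¬MS d (residual at every scale), SPen d (the born Hor body with the ratio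
clause replaced by the STRICT super-Penrose inequality m_ADM < √(A_min/16π), i.e. p > 1 — the SHARP
value of the grading quantity), d.IsTimeSymmetric (k ≡ 0) · thin · SPECIAL-TYPE · EMPTY BY THEOREM
IN PRINT: the Riemannian Penrose inequality (Bray 2001 Thm 1/19, Huisken–Ilmanen 2001; tree named
fact riemannian_penrose_inequality_outermost, OutermostHorizon.lean) — kernel
timeSymmetricPenroseCeiling_of_RPI : EnclosureRPI → TimeSymmetricPenroseCeiling with the po -/
@[route_item "route-FinalStateConjecture-RootDecompHorizonLadder"]
def TimeSymmetricPenroseCeiling : Prop :=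
  ∀ (X : Type) [TopologicalSpace X] [ChartedSpace Literature.Geometry.Lorentzian.E3 X] [IsManifold (𝓡 3) ((⊤ : ℕ∞) : WithTop ℕ∞) X] [T2Space X] [SecondCountableTopology X] [ConnectedSpace X], let P : Literature.Geometry.Lorentzian.InitialDataSet (𝓡 3) X → Prop := fun D ↦ (∃ 𝒟 : Literature.Geometry.Lorentzian.VacuumCauchyDevelopment D, 𝒟.IsMaximal) ∧ ∀ 𝒟 : Literature.Geometry.Lorentzian.VacuumCauchyDevelopment D, 𝒟.IsMaximal → Summit.FinalStateConjecture.HasCompleteNullInfinity 𝒟.toCauchyDevelopment ∧ ∃ (O : Set 𝒟.carrier) (d : Literature.Geometry.Lorentzian.FinalStateDecomposition 𝒟.toSpacetime O 2), (∀ i, Literature.Geometry.Lorentzian.Kerr.IsSubextremal (d.mass i) (d.spin i)) ∧ O = Summit.FinalStateConjecture.exteriorOf 𝒟.toCauchyDevelopment d.charted ∧ Summit.FinalStateConjecture.RaysStayInClosure 𝒟.toCauchyDevelopment O ∧ Summit.FinalStateConjecture.HasExhaustiveCharts d ∧ Summit.FinalStateConjecture.IsFutureOriented d; let K : Set (ℝ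 × ℝ) → Literature.Geometry.Lorentzian.InitialDataSet (𝓡 3) X → Prop := fun W D ↦ ∀ [Literature.Geometry.Lorentzian.Kerr.Facts] [Literature.Geometry.Lorentzian.Kerr.SliceFacts], ∃ (M a r₀ : ℝ) (hM : 0 < M), |a| < M ∧ (|a| / M, r₀ / M) ∈ W ∧ ∃ (θ : Literature.Geometry.Lorentzian.Kerr.slice a r₀ → X) (hθ : ContMDiff 𝓘(ℝ, Literature.Geometry.Lorentzian.E3) (𝓡 3) (((⊤ : ℕ∞) : WithTop ℕ∞) + 1) θ) (hθ' : ∀ u, Injective (mfderiv 𝓘(ℝ, Literature.Geometry.Lorentzian.E3) (𝓡 3) θ u)), Topology.IsOpenEmbedding θ ∧ IsCompact (range θ)ᶜ ∧ (∀ s' : ℕ, Literature.Geometry.Lorentzian.InitialDataSet.dataWeightedSobolevEDist s' (-1 : ℝ) (D.comap θ hθ hθ') (Literature.Geometry.Lorentzian.Kerr.data M a r₀ hM.le) < ⊤) ∧ Literature.Geometry.Lorentzian.InitialDataSet.dataWeightedSobolevEDist 6 (-1 : ℝ) (D.comap θ hθ hθ') (Literature.Geometry.Lorentzian.Kerr.data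 M a r₀ hM.le) < ENNReal.ofReal 1; let Mink : Literature.Geometry.Lorentzian.InitialDataSet (𝓡 3) X → Prop := fun D ↦ ∃ (θ : Literature.Geometry.Lorentzian.Minkowski.slice → X) (hθ : ContMDiff 𝓘(ℝ, Literature.Geometry.Lorentzian.E3) (𝓡 3) (((⊤ : ℕ∞) : WithTop ℕ∞) + 1) θ) (hθ' : ∀ u, Injective (mfderiv 𝓘(ℝ, Literature.Geometry.Lorentzian.E3) (𝓡 3) θ u)), Topology.IsOpenEmbedding θ ∧ Surjective θ ∧ (∀ s' : ℕ, Literature.Geometry.Lorentzian.InitialDataSet.dataWeightedSobolevEDist s' (-1 : ℝ) (D.comap θ hθ hθ') Literature.Geometry.Lorentzian.trivialData < ⊤) ∧ Literature.Geometry.Lorentzian.InitialDataSet.dataWeightedSobolevEDist 6 (-1 : ℝ) (D.comap θ hθ hθ') Literature.Geometry.Lorentzian.trivialData < ENNReal.ofReal 1; let pert : Set (ℝ × ℝ) := {p | p.1 ≤ (9 / 10 : ℝ) ∧ 1 - Real.sqrt (1 - p.1 ^ 2) < p.2 ∧ p.2 < 1 + Real.sqrt (1 - p.1 ^ 2)};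 let collar : Set (ℝ × ℝ) := {p | (9 / 10 : ℝ) < p.1 ∧ 1 - Real.sqrt (1 - p.1 ^ 2) < p.2 ∧ p.2 < 1 + Real.sqrt (1 - p.1 ^ 2)}; let shell : Set (ℝ × ℝ) := {p | 1 + Real.sqrt (1 - p.1 ^ 2) ≤ p.2 ∧ p.2 ≤ 3}; let Hor : Literature.Geometry.Lorentzian.InitialDataSet (𝓡 3) X → Prop := fun D ↦ ∃ (hLC : D.metric.HasLeviCivita) (e : Literature.Geometry.Lorentzian.AFEnd X) (S : Literature.Geometry.Lorentzian.OutermostMOTS (𝓡 3) D.h D.k), haveI : (Literature.Geometry.Lorentzian.PseudoRiemannianMetric.ofRiemannian D.h).HasLeviCivita := hLC; let IsExteriorRegion : TopologicalSpace.Opens X → Prop := fun U ↦ IsConnected (U : Set X) ∧ ∃ R', e.R < R' ∧ e.far R' ⊆ (U : Set X) ∧ IsCompact (closure (U : Set X) \ e.far R'); let IsOutsideOf : TopologicalSpace.Opens X → (S' : Type) → (f' : S' → X) → Literature.Geometry.Lorentzian.NormalField (𝓡 3) f' → Prop := fun U _ f' ν' ↦ frontier (U : Set X) = Set.range f' ∧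 (∀ y, ∀ᶠ t in nhdsWithin (0 : ℝ) (Set.Ioi 0), Literature.Geometry.Lorentzian.curveThrough (𝓡 3) (f' y) (ν' y) t ∈ (U : Set X)) ∧ (∀ y, ∀ᶠ t in nhdsWithin (0 : ℝ) (Set.Iio 0), Literature.Geometry.Lorentzian.curveThrough (𝓡 3) (f' y) (ν' y) t ∉ closure (U : Set X)) ∧ IsExteriorRegion U; let IsCalS : TopologicalSpace.Opens X → Prop := fun V ↦ ∃ (S' : Type) (_ : TopologicalSpace S') (_ : ChartedSpace (EuclideanSpace ℝ (Fin 2)) S') (_ : IsManifold (𝓡 2) ((⊤ : ℕ∞) : WithTop ℕ∞) S') (_ : CompactSpace S') (_ : T2Space S') (f' : S' → X) (ν' : Literature.Geometry.Lorentzian.NormalField (𝓡 3) f'), Manifold.IsSmoothEmbedding (𝓡 2) (𝓡 3) ((⊤ : ℕ∞) : WithTop ℕ∞) f' ∧ (Literature.Geometry.Lorentzian.PseudoRiemannianMetric.ofRiemannian D.h).IsUnitNormal (𝓡 2) f' ν' 1 ∧ IsOutsideOf V S' f' ν'; let WOTFree : TopologicalSpace.Opens X → Prop := fun U ↦ ∀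 (S' : Type) [TopologicalSpace S'] [ChartedSpace (EuclideanSpace ℝ (Fin 2)) S'] [IsManifold (𝓡 2) ((⊤ : ℕ∞) : WithTop ℕ∞) S'] [CompactSpace S'] [T2Space S'] (f' : S' → X) (ν' : Literature.Geometry.Lorentzian.NormalField (𝓡 3) f') (hpb' : Literature.Geometry.Lorentzian.PseudoRiemannianMetric.contMDiff_pullbackBilin (𝓡 3) X (𝓡 2) S' ((⊤ : ℕ∞) : WithTop ℕ∞)) (hf' : (Literature.Geometry.Lorentzian.PseudoRiemannianMetric.ofRiemannian D.h).IsSpacelikeImmersion (𝓡 2) f') (Ω : TopologicalSpace.Opens X), Manifold.IsSmoothEmbedding (𝓡 2) (𝓡 3) ((⊤ : ℕ∞) : WithTop ℕ∞) f' → Set.range f' ⊆ (U : Set X) → (Literature.Geometry.Lorentzian.PseudoRiemannianMetric.ofRiemannian D.h).IsUnitNormal (𝓡 2) f' ν' 1 → Nonempty S' → frontier (Ω : Set X) = Set.range f' → (∃ R', e.R < R' ∧ Disjoint (e.far R') (Ω : Set X)) → (∀ y, ∀ᶠ t in nhdsWithin (0 : ℝ) (Set.Iio 0), Literature.Geometry.Lorentzian.curveThrough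 (𝓡 3) (f' y) (ν' y) t ∈ (Ω : Set X)) → ¬ Literature.Geometry.Lorentzian.IsWeaklyOuterTrapped D.h D.k f' hpb' hf' ν'; ContMDiff (𝓡 2) (𝓡 3).tangent ((⊤ : ℕ∞) : WithTop ℕ∞) (fun y ↦ (Bundle.TotalSpace.mk' Literature.Geometry.Lorentzian.E3 (S.f y) (S.ν y) : TangentBundle (𝓡 3) X)) ∧ D.SatisfiesDominantEnergyCondition ∧ e.IsAsymptoticallyFlat D 1 ∧ D.IsComplete ∧ (∃ m, e.HasADMEnergy D m) ∧ (∀ i, ∃ p, e.HasADMMomentum D i p) ∧ WOTFree S.exterior ∧ IsOutsideOf S.exterior S.surf S.f S.ν ∧ 0 < e.admMass D ∧ (letI : MeasurableSpace X := borel X; haveI : BorelSpace X := ⟨rfl⟩; haveI : LocallyCompactSpace X := ChartedSpace.locallyCompactSpace Literature.Geometry.Lorentzian.E3 X; (9 / 10 : ℝ) * e.admMass D ≤ Real.sqrt ((⨅ (V : TopologicalSpace.Opens X) (_ : IsCalS V ∧ V ≤ S.exterior), Literature.Geometry.Lorentzian.area D.h (frontier (V : Set X))).toReal / (16 * Real.pi)));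 let SPen : Literature.Geometry.Lorentzian.InitialDataSet (𝓡 3) X → Prop := fun D ↦ ∃ (hLC : D.metric.HasLeviCivita) (e : Literature.Geometry.Lorentzian.AFEnd X) (S : Literature.Geometry.Lorentzian.OutermostMOTS (𝓡 3) D.h D.k), haveI : (Literature.Geometry.Lorentzian.PseudoRiemannianMetric.ofRiemannian D.h).HasLeviCivita := hLC; let IsExteriorRegion : TopologicalSpace.Opens X → Prop := fun U ↦ IsConnected (U : Set X) ∧ ∃ R', e.R < R' ∧ e.far R' ⊆ (U : Set X) ∧ IsCompact (closure (U : Set X) \ e.far R'); let IsOutsideOf : TopologicalSpace.Opens X → (S' : Type) → (f' : S' → X) → Literature.Geometry.Lorentzian.NormalField (𝓡 3) f' → Prop := fun U _ f' ν' ↦ frontier (U : Set X) = Set.range f' ∧ (∀ y, ∀ᶠ t in nhdsWithin (0 : ℝ) (Set.Ioi 0), Literature.Geometry.Lorentzian.curveThrough (𝓡 3) (f' y) (ν' y) t ∈ (U : Set X)) ∧ (∀ y, ∀ᶠ t in nhdsWithin (0 : ℝ) (Set.Iio 0), Literature.Geometry.Lorentzian.curveThrough (𝓡 3) (f' y) (ν'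 y) t ∉ closure (U : Set X)) ∧ IsExteriorRegion U; let IsCalS : TopologicalSpace.Opens X → Prop := fun V ↦ ∃ (S' : Type) (_ : TopologicalSpace S') (_ : ChartedSpace (EuclideanSpace ℝ (Fin 2)) S') (_ : IsManifold (𝓡 2) ((⊤ : ℕ∞) : WithTop ℕ∞) S') (_ : CompactSpace S') (_ : T2Space S') (f' : S' → X) (ν' : Literature.Geometry.Lorentzian.NormalField (𝓡 3) f'), Manifold.IsSmoothEmbedding (𝓡 2) (𝓡 3) ((⊤ : ℕ∞) : WithTop ℕ∞) f' ∧ (Literature.Geometry.Lorentzian.PseudoRiemannianMetric.ofRiemannian D.h).IsUnitNormal (𝓡 2) f' ν' 1 ∧ IsOutsideOf V S' f' ν'; let WOTFree : TopologicalSpace.Opens X → Prop := fun U ↦ ∀ (S' : Type) [TopologicalSpace S'] [ChartedSpace (EuclideanSpace ℝ (Fin 2)) S'] [IsManifold (𝓡 2) ((⊤ : ℕ∞) : WithTop ℕ∞) S'] [CompactSpace S'] [T2Space S'] (f' : S' → X) (ν' : Literature.Geometry.Lorentzian.NormalField (𝓡 3) f') (hpb' : Literature.Geometry.Lorentzian.PseudoRiemannianMetric.contMDiff_pullbackBilin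 (𝓡 3) X (𝓡 2) S' ((⊤ : ℕ∞) : WithTop ℕ∞)) (hf' : (Literature.Geometry.Lorentzian.PseudoRiemannianMetric.ofRiemannian D.h).IsSpacelikeImmersion (𝓡 2) f') (Ω : TopologicalSpace.Opens X), Manifold.IsSmoothEmbedding (𝓡 2) (𝓡 3) ((⊤ : ℕ∞) : WithTop ℕ∞) f' → Set.range f' ⊆ (U : Set X) → (Literature.Geometry.Lorentzian.PseudoRiemannianMetric.ofRiemannian D.h).IsUnitNormal (𝓡 2) f' ν' 1 → Nonempty S' → frontier (Ω : Set X) = Set.range f' → (∃ R', e.R < R' ∧ Disjoint (e.far R') (Ω : Set X)) → (∀ y, ∀ᶠ t in nhdsWithin (0 : ℝ) (Set.Iio 0), Literature.Geometry.Lorentzian.curveThrough (𝓡 3) (f' y) (ν' y) t ∈ (Ω : Set X)) → ¬ Literature.Geometry.Lorentzian.IsWeaklyOuterTrapped D.h D.k f' hpb' hf' ν'; ContMDiff (𝓡 2) (𝓡 3).tangent ((⊤ : ℕ∞) : WithTop ℕ∞) (fun y ↦ (Bundle.TotalSpace.mk' Literature.Geometry.Lorentzian.E3 (S.f y) (S.ν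 y) : TangentBundle (𝓡 3) X)) ∧ D.SatisfiesDominantEnergyCondition ∧ e.IsAsymptoticallyFlat D 1 ∧ D.IsComplete ∧ (∃ m, e.HasADMEnergy D m) ∧ (∀ i, ∃ p, e.HasADMMomentum D i p) ∧ WOTFree S.exterior ∧ IsOutsideOf S.exterior S.surf S.f S.ν ∧ 0 < e.admMass D ∧ (letI : MeasurableSpace X := borel X; haveI : BorelSpace X := ⟨rfl⟩; haveI : LocallyCompactSpace X := ChartedSpace.locallyCompactSpace Literature.Geometry.Lorentzian.E3 X; e.admMass D < Real.sqrt ((⨅ (V : TopologicalSpace.Opens X) (_ : IsCalS V ∧ V ≤ S.exterior), Literature.Geometry.Lorentzian.area D.h (frontier (V : Set X))).toReal / (16 * Real.pi))); ∀ d ∈ Literature.Geometry.Lorentzian.admissibleVacuumData X, ¬ P d → (¬ K pert d ∧ ¬ K collar d ∧ ¬ K shell d ∧ ¬ Mink d) → Hor d → (¬ ∃ (l : ℝ) (hl : 0 < l), K pert (Literature.Geometry.Lorentzian.InitialDataSet.homothety d l hl) ∨ K collar (Literature.Geometry.Lorentzian.InitialDataSet.homothety d l hl) ∨ K shell (Literature.Geometry.Lorentzian.InitialDataSet.homothety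 d l hl) ∨ Mink (Literature.Geometry.Lorentzian.InitialDataSet.homothety d l hl)) → SPen d → Literature.Geometry.Lorentzian.InitialDataSet.IsTimeSymmetric d → ∃ (e : Literature.Geometry.Lorentzian.AFEnd X) (F : EuclideanSpace ℝ (Fin 1) → Literature.Geometry.Lorentzian.InitialDataSet (𝓡 3) X), Literature.Geometry.Lorentzian.InitialDataSet.IsTameDataFamily e 1 F ∧ Literature.Geometry.Lorentzian.InitialDataSet.IsImmersedAtZero 1 F ∧ F 0 = d ∧ Injective F ∧ (∀ c, F c ∈ Literature.Geometry.Lorentzian.admissibleVacuumData X) ∧ ∀ c ≠ 0, P (F c)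

-- parent: HorizonDominatedResidual · child (gen 1)
/--     item stmt-FinalStateConjecture-29337 · crux · rank 503 · open
    parent: HorizonDominatedResidual · by planner
    why it might fail: the general (k ≢ 0) Penrose inequality in the A_min-enclosure form is OPEN (Mars 2009; «formulation may have to be adjusted», Andersson–Bäckdahl–Blue); if it fails on the admissible vacuum class this cell is inhabited and then asks for genuine capture of a super-Penrose slice
    sources: Mars2009, BenDov2004, doi:10.1017/cbo9781139583961
[crux · NAMED-CONJECTURE LEAF · COUNTS in the census NAMED column (not as new residual mass) · = the
registered strong hypothesis «Penrose inequality (spacetime / enclosure A_min form)» BY NAME: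
Literature/StrongHypotheses/FinalStateConjecture.lean table row «Penrose inequality (spacetime
form)» (Penrose 1973; Mars 2009 §2–3), in tree as
Literature.Geometry.Lorentzian.PenroseInequalityConjecture (MassInequalities.lean, with the recorded
counterexample-in-form caveat) and the corrected PenroseInequalityEnclosureConjecture
(PenroseConjecture.lean), ∩ {admissible vacuum, k ≢ 0, every-scale residual, Hor 9/10} — steward
dedup rule: attack the named conjecture, not this leaf · BARRIER · IDEA-NEEDED · no new mass ·
critic 2026-08-30T06:16:02Z row 66 OVERRULED the lens tag «candidate aside» to residual-named: the
equivalence is tight both ways (S ⟹ Π₁ proved = Penrose's 1973 heuristic direction; SPen is open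
along tame curves, so one admissible violator kills Exit d and Π₁ with it)] [crux-or-aside · gen-5
cut of HorizonDominatedResidual (stmt-FinalStateConjecture-26560), lens-1 g5 node PenroseSaturation
· guards ¬MS d, SPen d (p > 1), ¬ d.IsTimeSymmetric (k ≢ 0) · thin · BARRIER / IDEA-NE -/
@[route_item "route-FinalStateConjecture-RootDecompHorizonLadder"]
def DynamicalPenroseCeiling : Prop :=
  ∀ (X : Type) [TopologicalSpace X] [ChartedSpace Literature.Geometry.Lorentzian.E3 X] [IsManifold (𝓡 3) ((⊤ : ℕ∞) : WithTop ℕ∞) X] [T2Space X] [SecondCountableTopology X] [ConnectedSpace X], let P : Literature.Geometry.Lorentzian.InitialDataSet (𝓡 3) X → Prop := fun D ↦ (∃ 𝒟 : Literature.Geometry.Lorentzian.VacuumCauchyDevelopment D, 𝒟.IsMaximal) ∧ ∀ 𝒟 : Literature.Geometry.Lorentzian.VacuumCauchyDevelopment D, 𝒟.IsMaximal → Summit.FinalStateConjecture.HasCompleteNullInfinity 𝒟.toCauchyDevelopment ∧ ∃ (O : Set 𝒟.carrier) (d : Literature.Geometry.Lorentzian.FinalStateDecomposition 𝒟.toSpacetime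 O 2), (∀ i, Literature.Geometry.Lorentzian.Kerr.IsSubextremal (d.mass i) (d.spin i)) ∧ O = Summit.FinalStateConjecture.exteriorOf 𝒟.toCauchyDevelopment d.charted ∧ Summit.FinalStateConjecture.RaysStayInClosure 𝒟.toCauchyDevelopment O ∧ Summit.FinalStateConjecture.HasExhaustiveCharts d ∧ Summit.FinalStateConjecture.IsFutureOriented d; let K : Set (ℝ × ℝ) → Literature.Geometry.Lorentzian.InitialDataSet (𝓡 3) X → Prop := fun W D ↦ ∀ [Literature.Geometry.Lorentzian.Kerr.Facts] [Literature.Geometry.Lorentzian.Kerr.SliceFacts], ∃ (M a r₀ : ℝ) (hM : 0 < M), |a| < M ∧ (|a| / M, r₀ / M) ∈ W ∧ ∃ (θ : Literature.Geometry.Lorentzian.Kerr.slice a r₀ → X) (hθ : ContMDiff 𝓘(ℝ, Literature.Geometry.Lorentzian.E3) (𝓡 3) (((⊤ : ℕ∞) : WithTop ℕ∞) + 1) θ) (hθ' : ∀ u, Injective (mfderiv 𝓘(ℝ, Literature.Geometry.Lorentzian.E3) (𝓡 3) θ u)), Topology.IsOpenEmbedding θ ∧ IsCompact (range θ)ᶜ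 ∧ (∀ s' : ℕ, Literature.Geometry.Lorentzian.InitialDataSet.dataWeightedSobolevEDist s' (-1 : ℝ) (D.comap θ hθ hθ') (Literature.Geometry.Lorentzian.Kerr.data M a r₀ hM.le) < ⊤) ∧ Literature.Geometry.Lorentzian.InitialDataSet.dataWeightedSobolevEDist 6 (-1 : ℝ) (D.comap θ hθ hθ') (Literature.Geometry.Lorentzian.Kerr.data M a r₀ hM.le) < ENNReal.ofReal 1; let Mink : Literature.Geometry.Lorentzian.InitialDataSet (𝓡 3) X → Prop := fun D ↦ ∃ (θ : Literature.Geometry.Lorentzian.Minkowski.slice → X) (hθ : ContMDiff 𝓘(ℝ, Literature.Geometry.Lorentzian.E3) (𝓡 3) (((⊤ : ℕ∞) : WithTop ℕ∞) + 1) θ) (hθ' : ∀ u, Injective (mfderiv 𝓘(ℝ, Literature.Geometry.Lorentzian.E3) (𝓡 3) θ u)), Topology.IsOpenEmbedding θ ∧ Surjective θ ∧ (∀ s' : ℕ, Literature.Geometry.Lorentzian.InitialDataSet.dataWeightedSobolevEDist s' (-1 : ℝ) (D.comap θ hθ hθ') Literature.Geometry.Lorentzian.trivialData < ⊤) ∧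 Literature.Geometry.Lorentzian.InitialDataSet.dataWeightedSobolevEDist 6 (-1 : ℝ) (D.comap θ hθ hθ') Literature.Geometry.Lorentzian.trivialData < ENNReal.ofReal 1; let pert : Set (ℝ × ℝ) := {p | p.1 ≤ (9 / 10 : ℝ) ∧ 1 - Real.sqrt (1 - p.1 ^ 2) < p.2 ∧ p.2 < 1 + Real.sqrt (1 - p.1 ^ 2)}; let collar : Set (ℝ × ℝ) := {p | (9 / 10 : ℝ) < p.1 ∧ 1 - Real.sqrt (1 - p.1 ^ 2) < p.2 ∧ p.2 < 1 + Real.sqrt (1 - p.1 ^ 2)}; let shell : Set (ℝ × ℝ) := {p | 1 + Real.sqrt (1 - p.1 ^ 2) ≤ p.2 ∧ p.2 ≤ 3}; let Hor : Literature.Geometry.Lorentzian.InitialDataSet (𝓡 3) X → Prop := fun D ↦ ∃ (hLC : D.metric.HasLeviCivita) (e : Literature.Geometry.Lorentzian.AFEnd X) (S : Literature.Geometry.Lorentzian.OutermostMOTS (𝓡 3) D.h D.k), haveI : (Literature.Geometry.Lorentzian.PseudoRiemannianMetric.ofRiemannian D.h).HasLeviCivita := hLC; let IsExteriorRegion : TopologicalSpace.Opens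 X → Prop := fun U ↦ IsConnected (U : Set X) ∧ ∃ R', e.R < R' ∧ e.far R' ⊆ (U : Set X) ∧ IsCompact (closure (U : Set X) \ e.far R'); let IsOutsideOf : TopologicalSpace.Opens X → (S' : Type) → (f' : S' → X) → Literature.Geometry.Lorentzian.NormalField (𝓡 3) f' → Prop := fun U _ f' ν' ↦ frontier (U : Set X) = Set.range f' ∧ (∀ y, ∀ᶠ t in nhdsWithin (0 : ℝ) (Set.Ioi 0), Literature.Geometry.Lorentzian.curveThrough (𝓡 3) (f' y) (ν' y) t ∈ (U : Set X)) ∧ (∀ y, ∀ᶠ t in nhdsWithin (0 : ℝ) (Set.Iio 0), Literature.Geometry.Lorentzian.curveThrough (𝓡 3) (f' y) (ν' y) t ∉ closure (U : Set X)) ∧ IsExteriorRegion U; let IsCalS : TopologicalSpace.Opens X → Prop := fun V ↦ ∃ (S' : Type) (_ : TopologicalSpace S') (_ : ChartedSpace (EuclideanSpace ℝ (Fin 2)) S') (_ : IsManifold (𝓡 2) ((⊤ : ℕ∞) : WithTop ℕ∞) S') (_ : CompactSpace S') (_ : T2Space S') (f' : S' → X) (ν' : Literature.Geometry.Lorentzian.NormalField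 (𝓡 3) f'), Manifold.IsSmoothEmbedding (𝓡 2) (𝓡 3) ((⊤ : ℕ∞) : WithTop ℕ∞) f' ∧ (Literature.Geometry.Lorentzian.PseudoRiemannianMetric.ofRiemannian D.h).IsUnitNormal (𝓡 2) f' ν' 1 ∧ IsOutsideOf V S' f' ν'; let WOTFree : TopologicalSpace.Opens X → Prop := fun U ↦ ∀ (S' : Type) [TopologicalSpace S'] [ChartedSpace (EuclideanSpace ℝ (Fin 2)) S'] [IsManifold (𝓡 2) ((⊤ : ℕ∞) : WithTop ℕ∞) S'] [CompactSpace S'] [T2Space S'] (f' : S' → X) (ν' : Literature.Geometry.Lorentzian.NormalField (𝓡 3) f') (hpb' : Literature.Geometry.Lorentzian.PseudoRiemannianMetric.contMDiff_pullbackBilin (𝓡 3) X (𝓡 2) S' ((⊤ : ℕ∞) : WithTop ℕ∞)) (hf' : (Literature.Geometry.Lorentzian.PseudoRiemannianMetric.ofRiemannian D.h).IsSpacelikeImmersion (𝓡 2) f') (Ω : TopologicalSpace.Opens X), Manifold.IsSmoothEmbedding (𝓡 2) (𝓡 3) ((⊤ : ℕ∞) : WithTop ℕ∞) f' → Set.range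 f' ⊆ (U : Set X) → (Literature.Geometry.Lorentzian.PseudoRiemannianMetric.ofRiemannian D.h).IsUnitNormal (𝓡 2) f' ν' 1 → Nonempty S' → frontier (Ω : Set X) = Set.range f' → (∃ R', e.R < R' ∧ Disjoint (e.far R') (Ω : Set X)) → (∀ y, ∀ᶠ t in nhdsWithin (0 : ℝ) (Set.Iio 0), Literature.Geometry.Lorentzian.curveThrough (𝓡 3) (f' y) (ν' y) t ∈ (Ω : Set X)) → ¬ Literature.Geometry.Lorentzian.IsWeaklyOuterTrapped D.h D.k f' hpb' hf' ν'; ContMDiff (𝓡 2) (𝓡 3).tangent ((⊤ : ℕ∞) : WithTop ℕ∞) (fun y ↦ (Bundle.TotalSpace.mk' Literature.Geometry.Lorentzian.E3 (S.f y) (S.ν y) : TangentBundle (𝓡 3) X)) ∧ D.SatisfiesDominantEnergyCondition ∧ e.IsAsymptoticallyFlat D 1 ∧ D.IsComplete ∧ (∃ m, e.HasADMEnergy D m) ∧ (∀ i, ∃ p, e.HasADMMomentum D i p) ∧ WOTFree S.exterior ∧ IsOutsideOf S.exterior S.surf S.f S.ν ∧ 0 < e.admMass D ∧ (letI : MeasurableSpace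 X := borel X; haveI : BorelSpace X := ⟨rfl⟩; haveI : LocallyCompactSpace X := ChartedSpace.locallyCompactSpace Literature.Geometry.Lorentzian.E3 X; (9 / 10 : ℝ) * e.admMass D ≤ Real.sqrt ((⨅ (V : TopologicalSpace.Opens X) (_ : IsCalS V ∧ V ≤ S.exterior), Literature.Geometry.Lorentzian.area D.h (frontier (V : Set X))).toReal / (16 * Real.pi))); let SPen : Literature.Geometry.Lorentzian.InitialDataSet (𝓡 3) X → Prop := fun D ↦ ∃ (hLC : D.metric.HasLeviCivita) (e : Literature.Geometry.Lorentzian.AFEnd X) (S : Literature.Geometry.Lorentzian.OutermostMOTS (𝓡 3) D.h D.k), haveI : (Literature.Geometry.Lorentzian.PseudoRiemannianMetric.ofRiemannian D.h).HasLeviCivita := hLC; let IsExteriorRegion : TopologicalSpace.Opens X → Prop := fun U ↦ IsConnected (U : Set X) ∧ ∃ R', e.R < R' ∧ e.far R' ⊆ (U : Set X) ∧ IsCompact (closure (U : Set X) \ e.far R'); let IsOutsideOf : TopologicalSpace.Opens X → (S' : Type) → (f' : S' → X) → Literature.Geometry.Lorentzian.NormalField (𝓡 3) f' → Prop := fun U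 _ f' ν' ↦ frontier (U : Set X) = Set.range f' ∧ (∀ y, ∀ᶠ t in nhdsWithin (0 : ℝ) (Set.Ioi 0), Literature.Geometry.Lorentzian.curveThrough (𝓡 3) (f' y) (ν' y) t ∈ (U : Set X)) ∧ (∀ y, ∀ᶠ t in nhdsWithin (0 : ℝ) (Set.Iio 0), Literature.Geometry.Lorentzian.curveThrough (𝓡 3) (f' y) (ν' y) t ∉ closure (U : Set X)) ∧ IsExteriorRegion U; let IsCalS : TopologicalSpace.Opens X → Prop := fun V ↦ ∃ (S' : Type) (_ : TopologicalSpace S') (_ : ChartedSpace (EuclideanSpace ℝ (Fin 2)) S') (_ : IsManifold (𝓡 2) ((⊤ : ℕ∞) : WithTop ℕ∞) S') (_ : CompactSpace S') (_ : T2Space S') (f' : S' → X) (ν' : Literature.Geometry.Lorentzian.NormalField (𝓡 3) f'), Manifold.IsSmoothEmbedding (𝓡 2) (𝓡 3) ((⊤ : ℕ∞) : WithTop ℕ∞) f' ∧ (Literature.Geometry.Lorentzian.PseudoRiemannianMetric.ofRiemannian D.h).IsUnitNormal (𝓡 2) f' ν' 1 ∧ IsOutsideOf V S' f' ν'; let WOTFree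 : TopologicalSpace.Opens X → Prop := fun U ↦ ∀ (S' : Type) [TopologicalSpace S'] [ChartedSpace (EuclideanSpace ℝ (Fin 2)) S'] [IsManifold (𝓡 2) ((⊤ : ℕ∞) : WithTop ℕ∞) S'] [CompactSpace S'] [T2Space S'] (f' : S' → X) (ν' : Literature.Geometry.Lorentzian.NormalField (𝓡 3) f') (hpb' : Literature.Geometry.Lorentzian.PseudoRiemannianMetric.contMDiff_pullbackBilin (𝓡 3) X (𝓡 2) S' ((⊤ : ℕ∞) : WithTop ℕ∞)) (hf' : (Literature.Geometry.Lorentzian.PseudoRiemannianMetric.ofRiemannian D.h).IsSpacelikeImmersion (𝓡 2) f') (Ω : TopologicalSpace.Opens X), Manifold.IsSmoothEmbedding (𝓡 2) (𝓡 3) ((⊤ : ℕ∞) : WithTop ℕ∞) f' → Set.range f' ⊆ (U : Set X) → (Literature.Geometry.Lorentzian.PseudoRiemannianMetric.ofRiemannian D.h).IsUnitNormal (𝓡 2) f' ν' 1 → Nonempty S' → frontier (Ω : Set X) = Set.range f' → (∃ R', e.R < R' ∧ Disjoint (e.far R') (Ω : Set X)) → (∀ y, ∀ᶠ t in nhdsWithin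 (0 : ℝ) (Set.Iio 0), Literature.Geometry.Lorentzian.curveThrough (𝓡 3) (f' y) (ν' y) t ∈ (Ω : Set X)) → ¬ Literature.Geometry.Lorentzian.IsWeaklyOuterTrapped D.h D.k f' hpb' hf' ν'; ContMDiff (𝓡 2) (𝓡 3).tangent ((⊤ : ℕ∞) : WithTop ℕ∞) (fun y ↦ (Bundle.TotalSpace.mk' Literature.Geometry.Lorentzian.E3 (S.f y) (S.ν y) : TangentBundle (𝓡 3) X)) ∧ D.SatisfiesDominantEnergyCondition ∧ e.IsAsymptoticallyFlat D 1 ∧ D.IsComplete ∧ (∃ m, e.HasADMEnergy D m) ∧ (∀ i, ∃ p, e.HasADMMomentum D i p) ∧ WOTFree S.exterior ∧ IsOutsideOf S.exterior S.surf S.f S.ν ∧ 0 < e.admMass D ∧ (letI : MeasurableSpace X := borel X; haveI : BorelSpace X := ⟨rfl⟩; haveI : LocallyCompactSpace X := ChartedSpace.locallyCompactSpace Literature.Geometry.Lorentzian.E3 X; e.admMass D < Real.sqrt ((⨅ (V : TopologicalSpace.Opens X) (_ : IsCalS V ∧ V ≤ S.exterior), Literature.Geometry.Lorentzian.area D.h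 (frontier (V : Set X))).toReal / (16 * Real.pi))); ∀ d ∈ Literature.Geometry.Lorentzian.admissibleVacuumData X, ¬ P d → (¬ K pert d ∧ ¬ K collar d ∧ ¬ K shell d ∧ ¬ Mink d) → Hor d → (¬ ∃ (l : ℝ) (hl : 0 < l), K pert (Literature.Geometry.Lorentzian.InitialDataSet.homothety d l hl) ∨ K collar (Literature.Geometry.Lorentzian.InitialDataSet.homothety d l hl) ∨ K shell (Literature.Geometry.Lorentzian.InitialDataSet.homothety d l hl) ∨ Mink (Literature.Geometry.Lorentzian.InitialDataSet.homothety d l hl)) → SPen d → ¬ Literature.Geometry.Lorentzian.InitialDataSet.IsTimeSymmetric d → ∃ (e : Literature.Geometry.Lorentzian.AFEnd X) (F : EuclideanSpace ℝ (Fin 1) → Literature.Geometry.Lorentzian.InitialDataSet (𝓡 3) X), Literature.Geometry.Lorentzian.InitialDataSet.IsTameDataFamily e 1 F ∧ Literature.Geometry.Lorentzian.InitialDataSet.IsImmersedAtZero 1 F ∧ F 0 = d ∧ Injective F ∧ (∀ c, F c ∈ Literature.Geometry.Lorentzian.admissibleVacuumData X) ∧ ∀ c ≠ 0, P (F c)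

-- parent: HorizonDominatedResidual · child (gen 1)
/--     item stmt-FinalStateConjecture-29338 · crux · rank 504 · open
    parent: HorizonDominatedResidual · by planner
    why it might fail: WCC + Kerr final state for large vacuum data whose slice already holds a near-Penrose-saturating horizon: pinched bags of gold with arbitrary scalar-flat cores (F10), Brill slices past the fold (K5), ≤ 1:8 binaries are members; the interior clause RaysStayInClosure is decided by no theorem
    sources: BrayRPI2001, KlainermanSzeftel2023, Corvino2000, arXiv:1109.2165, doi:10.2140/gt.2025.29.4911, Mars2009
[crux · NEW RESIDUAL of 26560 · WEAKER · COUNTS (replaces 26560 in the census together with Π₁'s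
named column) · INSTRUMENTABLE (K5 Brill χ = 0.9968/0.9862, F10 bags of gold at p = 1, K4 fold
pairs, far binaries q ≤ 0.119) · IDEA-NEEDED · PARKED AS TYPED after this cut · rung
PenroseSaturationRung typed PLAN-ONLY in HOME (S-implied; ε ineffective) · critic CLEARED
2026-08-30T06:16:02Z row 66] [crux · gen-5 cut of HorizonDominatedResidual
(stmt-FinalStateConjecture-26560), lens-1 g5 node PenroseSaturation · THE COUNTING PIECE · guards
¬MS d (no homothetic copy of d in any born model cell: residual at EVERY scale, kernel
not_ms_homothety_iff / residual_core_homothety) and ¬SPen d (NOT super-Penrose: with Hor d the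
enclosure Penrose quotient p(d) = √(A_min(S)/16π)/m_ADM lies in [9/10, 1] for every dominant-horizon
frame, equality p = 1 allowed) · WEAKER (kernel genuineHorizonDominated_of_summit, split_iff₄; ⇏
parent: silent on rescaled model data and on the super-Penrose stratum) · NEW RESIDUAL · COUNTS ·
INSTRUMENTABLE (census K5: single-blob supercritical Brill slices are born into this cell at χ =
0.9968 (Holz) / 0.9862 (Eppley) at the apparent-horizon fold and climb monotonically -/
@[route_item "route-FinalStateConjecture-RootDecompHorizonLadder"]
def GenuineHorizonDominated : Prop :=
  ∀ (X : Type) [TopologicalSpace X] [ChartedSpace Literature.Geometry.Lorentzian.E3 X] [IsManifold (𝓡 3) ((⊤ : ℕ∞) : WithTop ℕ∞) X] [T2Space X] [SecondCountableTopology X] [ConnectedSpace X], let P : Literature.Geometry.Lorentzian.InitialDataSet (𝓡 3) X → Prop := fun D ↦ (∃ 𝒟 : Literature.Geometry.Lorentzian.VacuumCauchyDevelopment D, 𝒟.IsMaximal) ∧ ∀ 𝒟 : Literature.Geometry.Lorentzian.VacuumCauchyDevelopment D, 𝒟.IsMaximal → Summit.FinalStateConjecture.HasCompleteNullInfinity 𝒟.toCauchyDevelopment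 ∧ ∃ (O : Set 𝒟.carrier) (d : Literature.Geometry.Lorentzian.FinalStateDecomposition 𝒟.toSpacetime O 2), (∀ i, Literature.Geometry.Lorentzian.Kerr.IsSubextremal (d.mass i) (d.spin i)) ∧ O = Summit.FinalStateConjecture.exteriorOf 𝒟.toCauchyDevelopment d.charted ∧ Summit.FinalStateConjecture.RaysStayInClosure 𝒟.toCauchyDevelopment O ∧ Summit.FinalStateConjecture.HasExhaustiveCharts d ∧ Summit.FinalStateConjecture.IsFutureOriented d; let K : Set (ℝ × ℝ) → Literature.Geometry.Lorentzian.InitialDataSet (𝓡 3) X → Prop := fun W D ↦ ∀ [Literature.Geometry.Lorentzian.Kerr.Facts] [Literature.Geometry.Lorentzian.Kerr.SliceFacts], ∃ (M a r₀ : ℝ) (hM : 0 < M), |a| < M ∧ (|a| / M, r₀ / M) ∈ W ∧ ∃ (θ : Literature.Geometry.Lorentzian.Kerr.slice a r₀ → X) (hθ : ContMDiff 𝓘(ℝ, Literature.Geometry.Lorentzian.E3) (𝓡 3) (((⊤ : ℕ∞) : WithTop ℕ∞) + 1) θ) (hθ' : ∀ u, Injective (mfderiv 𝓘(ℝ, Literature.Geometry.Lorentzian.E3)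 (𝓡 3) θ u)), Topology.IsOpenEmbedding θ ∧ IsCompact (range θ)ᶜ ∧ (∀ s' : ℕ, Literature.Geometry.Lorentzian.InitialDataSet.dataWeightedSobolevEDist s' (-1 : ℝ) (D.comap θ hθ hθ') (Literature.Geometry.Lorentzian.Kerr.data M a r₀ hM.le) < ⊤) ∧ Literature.Geometry.Lorentzian.InitialDataSet.dataWeightedSobolevEDist 6 (-1 : ℝ) (D.comap θ hθ hθ') (Literature.Geometry.Lorentzian.Kerr.data M a r₀ hM.le) < ENNReal.ofReal 1; let Mink : Literature.Geometry.Lorentzian.InitialDataSet (𝓡 3) X → Prop := fun D ↦ ∃ (θ : Literature.Geometry.Lorentzian.Minkowski.slice → X) (hθ : ContMDiff 𝓘(ℝ, Literature.Geometry.Lorentzian.E3) (𝓡 3) (((⊤ : ℕ∞) : WithTop ℕ∞) + 1) θ) (hθ' : ∀ u, Injective (mfderiv 𝓘(ℝ, Literature.Geometry.Lorentzian.E3) (𝓡 3) θ u)), Topology.IsOpenEmbedding θ ∧ Surjective θ ∧ (∀ s' : ℕ, Literature.Geometry.Lorentzian.InitialDataSet.dataWeightedSobolevEDist s' (-1 :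 ℝ) (D.comap θ hθ hθ') Literature.Geometry.Lorentzian.trivialData < ⊤) ∧ Literature.Geometry.Lorentzian.InitialDataSet.dataWeightedSobolevEDist 6 (-1 : ℝ) (D.comap θ hθ hθ') Literature.Geometry.Lorentzian.trivialData < ENNReal.ofReal 1; let pert : Set (ℝ × ℝ) := {p | p.1 ≤ (9 / 10 : ℝ) ∧ 1 - Real.sqrt (1 - p.1 ^ 2) < p.2 ∧ p.2 < 1 + Real.sqrt (1 - p.1 ^ 2)}; let collar : Set (ℝ × ℝ) := {p | (9 / 10 : ℝ) < p.1 ∧ 1 - Real.sqrt (1 - p.1 ^ 2) < p.2 ∧ p.2 < 1 + Real.sqrt (1 - p.1 ^ 2)}; let shell : Set (ℝ × ℝ) := {p | 1 + Real.sqrt (1 - p.1 ^ 2) ≤ p.2 ∧ p.2 ≤ 3}; let Hor : Literature.Geometry.Lorentzian.InitialDataSet (𝓡 3) X → Prop := fun D ↦ ∃ (hLC : D.metric.HasLeviCivita) (e : Literature.Geometry.Lorentzian.AFEnd X) (S : Literature.Geometry.Lorentzian.OutermostMOTS (𝓡 3) D.h D.k), haveI : (Literature.Geometry.Lorentzian.PseudoRiemannianMetric.ofRiemannian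 D.h).HasLeviCivita := hLC; let IsExteriorRegion : TopologicalSpace.Opens X → Prop := fun U ↦ IsConnected (U : Set X) ∧ ∃ R', e.R < R' ∧ e.far R' ⊆ (U : Set X) ∧ IsCompact (closure (U : Set X) \ e.far R'); let IsOutsideOf : TopologicalSpace.Opens X → (S' : Type) → (f' : S' → X) → Literature.Geometry.Lorentzian.NormalField (𝓡 3) f' → Prop := fun U _ f' ν' ↦ frontier (U : Set X) = Set.range f' ∧ (∀ y, ∀ᶠ t in nhdsWithin (0 : ℝ) (Set.Ioi 0), Literature.Geometry.Lorentzian.curveThrough (𝓡 3) (f' y) (ν' y) t ∈ (U : Set X)) ∧ (∀ y, ∀ᶠ t in nhdsWithin (0 : ℝ) (Set.Iio 0), Literature.Geometry.Lorentzian.curveThrough (𝓡 3) (f' y) (ν' y) t ∉ closure (U : Set X)) ∧ IsExteriorRegion U; let IsCalS : TopologicalSpace.Opens X → Prop := fun V ↦ ∃ (S' : Type) (_ : TopologicalSpace S') (_ : ChartedSpace (EuclideanSpace ℝ (Fin 2)) S') (_ : IsManifold (𝓡 2) ((⊤ : ℕ∞) : WithTop ℕ∞) S') (_ : CompactSpace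 S') (_ : T2Space S') (f' : S' → X) (ν' : Literature.Geometry.Lorentzian.NormalField (𝓡 3) f'), Manifold.IsSmoothEmbedding (𝓡 2) (𝓡 3) ((⊤ : ℕ∞) : WithTop ℕ∞) f' ∧ (Literature.Geometry.Lorentzian.PseudoRiemannianMetric.ofRiemannian D.h).IsUnitNormal (𝓡 2) f' ν' 1 ∧ IsOutsideOf V S' f' ν'; let WOTFree : TopologicalSpace.Opens X → Prop := fun U ↦ ∀ (S' : Type) [TopologicalSpace S'] [ChartedSpace (EuclideanSpace ℝ (Fin 2)) S'] [IsManifold (𝓡 2) ((⊤ : ℕ∞) : WithTop ℕ∞) S'] [CompactSpace S'] [T2Space S'] (f' : S' → X) (ν' : Literature.Geometry.Lorentzian.NormalField (𝓡 3) f') (hpb' : Literature.Geometry.Lorentzian.PseudoRiemannianMetric.contMDiff_pullbackBilin (𝓡 3) X (𝓡 2) S' ((⊤ : ℕ∞) : WithTop ℕ∞)) (hf' : (Literature.Geometry.Lorentzian.PseudoRiemannianMetric.ofRiemannian D.h).IsSpacelikeImmersion (𝓡 2) f') (Ω : TopologicalSpace.Opens X), Manifold.IsSmoothEmbedding (𝓡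 2) (𝓡 3) ((⊤ : ℕ∞) : WithTop ℕ∞) f' → Set.range f' ⊆ (U : Set X) → (Literature.Geometry.Lorentzian.PseudoRiemannianMetric.ofRiemannian D.h).IsUnitNormal (𝓡 2) f' ν' 1 → Nonempty S' → frontier (Ω : Set X) = Set.range f' → (∃ R', e.R < R' ∧ Disjoint (e.far R') (Ω : Set X)) → (∀ y, ∀ᶠ t in nhdsWithin (0 : ℝ) (Set.Iio 0), Literature.Geometry.Lorentzian.curveThrough (𝓡 3) (f' y) (ν' y) t ∈ (Ω : Set X)) → ¬ Literature.Geometry.Lorentzian.IsWeaklyOuterTrapped D.h D.k f' hpb' hf' ν'; ContMDiff (𝓡 2) (𝓡 3).tangent ((⊤ : ℕ∞) : WithTop ℕ∞) (fun y ↦ (Bundle.TotalSpace.mk' Literature.Geometry.Lorentzian.E3 (S.f y) (S.ν y) : TangentBundle (𝓡 3) X)) ∧ D.SatisfiesDominantEnergyCondition ∧ e.IsAsymptoticallyFlat D 1 ∧ D.IsComplete ∧ (∃ m, e.HasADMEnergy D m) ∧ (∀ i, ∃ p, e.HasADMMomentum D i p) ∧ WOTFree S.exterior ∧ IsOutsideOf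 S.exterior S.surf S.f S.ν ∧ 0 < e.admMass D ∧ (letI : MeasurableSpace X := borel X; haveI : BorelSpace X := ⟨rfl⟩; haveI : LocallyCompactSpace X := ChartedSpace.locallyCompactSpace Literature.Geometry.Lorentzian.E3 X; (9 / 10 : ℝ) * e.admMass D ≤ Real.sqrt ((⨅ (V : TopologicalSpace.Opens X) (_ : IsCalS V ∧ V ≤ S.exterior), Literature.Geometry.Lorentzian.area D.h (frontier (V : Set X))).toReal / (16 * Real.pi))); let SPen : Literature.Geometry.Lorentzian.InitialDataSet (𝓡 3) X → Prop := fun D ↦ ∃ (hLC : D.metric.HasLeviCivita) (e : Literature.Geometry.Lorentzian.AFEnd X) (S : Literature.Geometry.Lorentzian.OutermostMOTS (𝓡 3) D.h D.k), haveI : (Literature.Geometry.Lorentzian.PseudoRiemannianMetric.ofRiemannian D.h).HasLeviCivita := hLC; let IsExteriorRegion : TopologicalSpace.Opens X → Prop := fun U ↦ IsConnected (U : Set X) ∧ ∃ R', e.R < R' ∧ e.far R' ⊆ (U : Set X) ∧ IsCompact (closure (U : Set X) \ e.far R'); let IsOutsideOf : TopologicalSpace.Opens X → (S' : Type) → (f'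 : S' → X) → Literature.Geometry.Lorentzian.NormalField (𝓡 3) f' → Prop := fun U _ f' ν' ↦ frontier (U : Set X) = Set.range f' ∧ (∀ y, ∀ᶠ t in nhdsWithin (0 : ℝ) (Set.Ioi 0), Literature.Geometry.Lorentzian.curveThrough (𝓡 3) (f' y) (ν' y) t ∈ (U : Set X)) ∧ (∀ y, ∀ᶠ t in nhdsWithin (0 : ℝ) (Set.Iio 0), Literature.Geometry.Lorentzian.curveThrough (𝓡 3) (f' y) (ν' y) t ∉ closure (U : Set X)) ∧ IsExteriorRegion U; let IsCalS : TopologicalSpace.Opens X → Prop := fun V ↦ ∃ (S' : Type) (_ : TopologicalSpace S') (_ : ChartedSpace (EuclideanSpace ℝ (Fin 2)) S') (_ : IsManifold (𝓡 2) ((⊤ : ℕ∞) : WithTop ℕ∞) S') (_ : CompactSpace S') (_ : T2Space S') (f' : S' → X) (ν' : Literature.Geometry.Lorentzian.NormalField (𝓡 3) f'), Manifold.IsSmoothEmbedding (𝓡 2) (𝓡 3) ((⊤ : ℕ∞) : WithTop ℕ∞) f' ∧ (Literature.Geometry.Lorentzian.PseudoRiemannianMetric.ofRiemannian D.h).IsUnitNormal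 (𝓡 2) f' ν' 1 ∧ IsOutsideOf V S' f' ν'; let WOTFree : TopologicalSpace.Opens X → Prop := fun U ↦ ∀ (S' : Type) [TopologicalSpace S'] [ChartedSpace (EuclideanSpace ℝ (Fin 2)) S'] [IsManifold (𝓡 2) ((⊤ : ℕ∞) : WithTop ℕ∞) S'] [CompactSpace S'] [T2Space S'] (f' : S' → X) (ν' : Literature.Geometry.Lorentzian.NormalField (𝓡 3) f') (hpb' : Literature.Geometry.Lorentzian.PseudoRiemannianMetric.contMDiff_pullbackBilin (𝓡 3) X (𝓡 2) S' ((⊤ : ℕ∞) : WithTop ℕ∞)) (hf' : (Literature.Geometry.Lorentzian.PseudoRiemannianMetric.ofRiemannian D.h).IsSpacelikeImmersion (𝓡 2) f') (Ω : TopologicalSpace.Opens X), Manifold.IsSmoothEmbedding (𝓡 2) (𝓡 3) ((⊤ : ℕ∞) : WithTop ℕ∞) f' → Set.range f' ⊆ (U : Set X) → (Literature.Geometry.Lorentzian.PseudoRiemannianMetric.ofRiemannian D.h).IsUnitNormal (𝓡 2) f' ν' 1 → Nonempty S' → frontier (Ω : Set X) = Set.range f' → (∃ R', e.R < R' ∧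 Disjoint (e.far R') (Ω : Set X)) → (∀ y, ∀ᶠ t in nhdsWithin (0 : ℝ) (Set.Iio 0), Literature.Geometry.Lorentzian.curveThrough (𝓡 3) (f' y) (ν' y) t ∈ (Ω : Set X)) → ¬ Literature.Geometry.Lorentzian.IsWeaklyOuterTrapped D.h D.k f' hpb' hf' ν'; ContMDiff (𝓡 2) (𝓡 3).tangent ((⊤ : ℕ∞) : WithTop ℕ∞) (fun y ↦ (Bundle.TotalSpace.mk' Literature.Geometry.Lorentzian.E3 (S.f y) (S.ν y) : TangentBundle (𝓡 3) X)) ∧ D.SatisfiesDominantEnergyCondition ∧ e.IsAsymptoticallyFlat D 1 ∧ D.IsComplete ∧ (∃ m, e.HasADMEnergy D m) ∧ (∀ i, ∃ p, e.HasADMMomentum D i p) ∧ WOTFree S.exterior ∧ IsOutsideOf S.exterior S.surf S.f S.ν ∧ 0 < e.admMass D ∧ (letI : MeasurableSpace X := borel X; haveI : BorelSpace X := ⟨rfl⟩; haveI : LocallyCompactSpace X := ChartedSpace.locallyCompactSpace Literature.Geometry.Lorentzian.E3 X; e.admMass D < Real.sqrt ((⨅ (V : TopologicalSpace.Opens X)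 (_ : IsCalS V ∧ V ≤ S.exterior), Literature.Geometry.Lorentzian.area D.h (frontier (V : Set X))).toReal / (16 * Real.pi))); ∀ d ∈ Literature.Geometry.Lorentzian.admissibleVacuumData X, ¬ P d → (¬ K pert d ∧ ¬ K collar d ∧ ¬ K shell d ∧ ¬ Mink d) → Hor d → (¬ ∃ (l : ℝ) (hl : 0 < l), K pert (Literature.Geometry.Lorentzian.InitialDataSet.homothety d l hl) ∨ K collar (Literature.Geometry.Lorentzian.InitialDataSet.homothety d l hl) ∨ K shell (Literature.Geometry.Lorentzian.InitialDataSet.homothety d l hl) ∨ Mink (Literature.Geometry.Lorentzian.InitialDataSet.homothety d l hl)) → ¬ SPen d → ∃ (e : Literature.Geometry.Lorentzian.AFEnd X) (F : EuclideanSpace ℝ (Fin 1) → Literature.Geometry.Lorentzian.InitialDataSet (𝓡 3) X), Literature.Geometry.Lorentzian.InitialDataSet.IsTameDataFamily e 1 F ∧ Literature.Geometry.Lorentzian.InitialDataSet.IsImmersedAtZero 1 F ∧ F 0 = d ∧ Injective F ∧ (∀ c, F c ∈ Literature.Geometry.Lorentzian.admissibleVacuumData X) ∧ ∀ c ≠ 0,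 P (F c)

-- parent: HorizonDominatedResidual · child (gen 1)
/--     item stmt-FinalStateConjecture-29335 · support · rank 501 · open
    parent: HorizonDominatedResidual · by planner
    why it might fail: only through the ports: P-invariance under homothety (CureScaleCovariant) needs the MGHD / null-infinity / Kerr-chart vocabulary to be dilation-covariant as typed (Kerr.exteriorChart (lM, la)); a typed absolute constant in HasCompleteNullInfinity or FinalStateDecomposition … 2 would break S3
    sources: KlainermanSzeftel2023, ChristodoulouKlainerman1993, wi-96944
[support · THIN · DOMINATED (born 25092/25089/25090/25093 + homothety ports AdmissibleDilationClosed
/ CureScaleCovariant / TameExitDilation = D6 wi-96944; kernel scaledModelCapture_of_ports,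
closes₈_of_ports) · does NOT count · ATTACKABLE NOW (porting) · critic CLEARED 2026-08-30T06:16:02Z
row 66] [crux · gen-5 cut of HorizonDominatedResidual (stmt-FinalStateConjecture-26560), lens-1 g5
node PenroseSaturation · guard MS d: SOME homothetic copy (l²h, lk), l > 0, of d lies in one of the
FOUR born model cells (K pert / K collar / K shell / Mink) — scale saturation of the whole model
layer of N1b (caution c7; kernel MS, ms_iff_exists_not_R, ms_homothety_iff) · WEAKER (kernel
scaledModelCapture_of_summit; ⇏ parent: silent on data residual at every scale) · thin · NOT a new
mechanism · DOES NOT COUNT · ATTACKABLE NOW (porting) — DOMINATED in the kernel by the born cells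
PerturbativeCapture 25092 / NearExtremalCapture 25089 / EnclosedCoreCapture 25090 /
SmallDataDispersal 25093 through the dilation covariance of the vacuum Cauchy problem:
scaledModelCapture_of_ports : AdmissibleDilationClosed → CureScaleCovariant → TameExitDilation →
PertCell → CollarCell → ShellCell → MinkCell → ScaledM -/
@[route_item "route-FinalStateConjecture-RootDecompHorizonLadder"]
def ScaledModelCapture : Prop :=
  ∀ (X : Type) [TopologicalSpace X] [ChartedSpace Literature.Geometry.Lorentzian.E3 X] [IsManifold (𝓡 3) ((⊤ : ℕ∞) : WithTop ℕ∞) X] [T2Space X] [SecondCountableTopology X] [ConnectedSpace X], let P : Literature.Geometry.Lorentzian.InitialDataSet (𝓡 3) X → Prop := fun D ↦ (∃ 𝒟 : Literature.Geometry.Lorentzian.VacuumCauchyDevelopment D, 𝒟.IsMaximal) ∧ ∀ 𝒟 : Literature.Geometry.Lorentzian.VacuumCauchyDevelopment D, 𝒟.IsMaximal → Summit.FinalStateConjecture.HasCompleteNullInfinity 𝒟.toCauchyDevelopment ∧ ∃ (O : Set 𝒟.carrier) (d : Literature.Geometry.Lorentzian.FinalStateDecomposition 𝒟.toSpacetime O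 2), (∀ i, Literature.Geometry.Lorentzian.Kerr.IsSubextremal (d.mass i) (d.spin i)) ∧ O = Summit.FinalStateConjecture.exteriorOf 𝒟.toCauchyDevelopment d.charted ∧ Summit.FinalStateConjecture.RaysStayInClosure 𝒟.toCauchyDevelopment O ∧ Summit.FinalStateConjecture.HasExhaustiveCharts d ∧ Summit.FinalStateConjecture.IsFutureOriented d; let K : Set (ℝ × ℝ) → Literature.Geometry.Lorentzian.InitialDataSet (𝓡 3) X → Prop := fun W D ↦ ∀ [Literature.Geometry.Lorentzian.Kerr.Facts] [Literature.Geometry.Lorentzian.Kerr.SliceFacts], ∃ (M a r₀ : ℝ) (hM : 0 < M), |a| < M ∧ (|a| / M, r₀ / M) ∈ W ∧ ∃ (θ : Literature.Geometry.Lorentzian.Kerr.slice a r₀ → X) (hθ : ContMDiff 𝓘(ℝ, Literature.Geometry.Lorentzian.E3) (𝓡 3) (((⊤ : ℕ∞) : WithTop ℕ∞) + 1) θ) (hθ' : ∀ u, Injective (mfderiv 𝓘(ℝ, Literature.Geometry.Lorentzian.E3) (𝓡 3) θ u)), Topology.IsOpenEmbedding θ ∧ IsCompact (range θ)ᶜ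 ∧ (∀ s' : ℕ, Literature.Geometry.Lorentzian.InitialDataSet.dataWeightedSobolevEDist s' (-1 : ℝ) (D.comap θ hθ hθ') (Literature.Geometry.Lorentzian.Kerr.data M a r₀ hM.le) < ⊤) ∧ Literature.Geometry.Lorentzian.InitialDataSet.dataWeightedSobolevEDist 6 (-1 : ℝ) (D.comap θ hθ hθ') (Literature.Geometry.Lorentzian.Kerr.data M a r₀ hM.le) < ENNReal.ofReal 1; let Mink : Literature.Geometry.Lorentzian.InitialDataSet (𝓡 3) X → Prop := fun D ↦ ∃ (θ : Literature.Geometry.Lorentzian.Minkowski.slice → X) (hθ : ContMDiff 𝓘(ℝ, Literature.Geometry.Lorentzian.E3) (𝓡 3) (((⊤ : ℕ∞) : WithTop ℕ∞) + 1) θ) (hθ' : ∀ u, Injective (mfderiv 𝓘(ℝ, Literature.Geometry.Lorentzian.E3) (𝓡 3) θ u)), Topology.IsOpenEmbedding θ ∧ Surjective θ ∧ (∀ s' : ℕ, Literature.Geometry.Lorentzian.InitialDataSet.dataWeightedSobolevEDist s' (-1 : ℝ) (D.comap θ hθ hθ') Literature.Geometry.Lorentzian.trivialData < ⊤) ∧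 Literature.Geometry.Lorentzian.InitialDataSet.dataWeightedSobolevEDist 6 (-1 : ℝ) (D.comap θ hθ hθ') Literature.Geometry.Lorentzian.trivialData < ENNReal.ofReal 1; let pert : Set (ℝ × ℝ) := {p | p.1 ≤ (9 / 10 : ℝ) ∧ 1 - Real.sqrt (1 - p.1 ^ 2) < p.2 ∧ p.2 < 1 + Real.sqrt (1 - p.1 ^ 2)}; let collar : Set (ℝ × ℝ) := {p | (9 / 10 : ℝ) < p.1 ∧ 1 - Real.sqrt (1 - p.1 ^ 2) < p.2 ∧ p.2 < 1 + Real.sqrt (1 - p.1 ^ 2)}; let shell : Set (ℝ × ℝ) := {p | 1 + Real.sqrt (1 - p.1 ^ 2) ≤ p.2 ∧ p.2 ≤ 3}; let Hor : Literature.Geometry.Lorentzian.InitialDataSet (𝓡 3) X → Prop := fun D ↦ ∃ (hLC : D.metric.HasLeviCivita) (e : Literature.Geometry.Lorentzian.AFEnd X) (S : Literature.Geometry.Lorentzian.OutermostMOTS (𝓡 3) D.h D.k), haveI : (Literature.Geometry.Lorentzian.PseudoRiemannianMetric.ofRiemannian D.h).HasLeviCivita := hLC; let IsExteriorRegion : TopologicalSpace.Opens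 X → Prop := fun U ↦ IsConnected (U : Set X) ∧ ∃ R', e.R < R' ∧ e.far R' ⊆ (U : Set X) ∧ IsCompact (closure (U : Set X) \ e.far R'); let IsOutsideOf : TopologicalSpace.Opens X → (S' : Type) → (f' : S' → X) → Literature.Geometry.Lorentzian.NormalField (𝓡 3) f' → Prop := fun U _ f' ν' ↦ frontier (U : Set X) = Set.range f' ∧ (∀ y, ∀ᶠ t in nhdsWithin (0 : ℝ) (Set.Ioi 0), Literature.Geometry.Lorentzian.curveThrough (𝓡 3) (f' y) (ν' y) t ∈ (U : Set X)) ∧ (∀ y, ∀ᶠ t in nhdsWithin (0 : ℝ) (Set.Iio 0), Literature.Geometry.Lorentzian.curveThrough (𝓡 3) (f' y) (ν' y) t ∉ closure (U : Set X)) ∧ IsExteriorRegion U; let IsCalS : TopologicalSpace.Opens X → Prop := fun V ↦ ∃ (S' : Type) (_ : TopologicalSpace S') (_ : ChartedSpace (EuclideanSpace ℝ (Fin 2)) S') (_ : IsManifold (𝓡 2) ((⊤ : ℕ∞) : WithTop ℕ∞) S') (_ : CompactSpace S') (_ : T2Space S') (f' : S' → X) (ν' : Literature.Geometry.Lorentzian.NormalField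 (𝓡 3) f'), Manifold.IsSmoothEmbedding (𝓡 2) (𝓡 3) ((⊤ : ℕ∞) : WithTop ℕ∞) f' ∧ (Literature.Geometry.Lorentzian.PseudoRiemannianMetric.ofRiemannian D.h).IsUnitNormal (𝓡 2) f' ν' 1 ∧ IsOutsideOf V S' f' ν'; let WOTFree : TopologicalSpace.Opens X → Prop := fun U ↦ ∀ (S' : Type) [TopologicalSpace S'] [ChartedSpace (EuclideanSpace ℝ (Fin 2)) S'] [IsManifold (𝓡 2) ((⊤ : ℕ∞) : WithTop ℕ∞) S'] [CompactSpace S'] [T2Space S'] (f' : S' → X) (ν' : Literature.Geometry.Lorentzian.NormalField (𝓡 3) f') (hpb' : Literature.Geometry.Lorentzian.PseudoRiemannianMetric.contMDiff_pullbackBilin (𝓡 3) X (𝓡 2) S' ((⊤ : ℕ∞) : WithTop ℕ∞)) (hf' : (Literature.Geometry.Lorentzian.PseudoRiemannianMetric.ofRiemannian D.h).IsSpacelikeImmersion (𝓡 2) f') (Ω : TopologicalSpace.Opens X), Manifold.IsSmoothEmbedding (𝓡 2) (𝓡 3) ((⊤ : ℕ∞) : WithTop ℕ∞) f' → Set.range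 f' ⊆ (U : Set X) → (Literature.Geometry.Lorentzian.PseudoRiemannianMetric.ofRiemannian D.h).IsUnitNormal (𝓡 2) f' ν' 1 → Nonempty S' → frontier (Ω : Set X) = Set.range f' → (∃ R', e.R < R' ∧ Disjoint (e.far R') (Ω : Set X)) → (∀ y, ∀ᶠ t in nhdsWithin (0 : ℝ) (Set.Iio 0), Literature.Geometry.Lorentzian.curveThrough (𝓡 3) (f' y) (ν' y) t ∈ (Ω : Set X)) → ¬ Literature.Geometry.Lorentzian.IsWeaklyOuterTrapped D.h D.k f' hpb' hf' ν'; ContMDiff (𝓡 2) (𝓡 3).tangent ((⊤ : ℕ∞) : WithTop ℕ∞) (fun y ↦ (Bundle.TotalSpace.mk' Literature.Geometry.Lorentzian.E3 (S.f y) (S.ν y) : TangentBundle (𝓡 3) X)) ∧ D.SatisfiesDominantEnergyCondition ∧ e.IsAsymptoticallyFlat D 1 ∧ D.IsComplete ∧ (∃ m, e.HasADMEnergy D m) ∧ (∀ i, ∃ p, e.HasADMMomentum D i p) ∧ WOTFree S.exterior ∧ IsOutsideOf S.exterior S.surf S.f S.ν ∧ 0 < e.admMass D ∧ (letI : MeasurableSpace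 X := borel X; haveI : BorelSpace X := ⟨rfl⟩; haveI : LocallyCompactSpace X := ChartedSpace.locallyCompactSpace Literature.Geometry.Lorentzian.E3 X; (9 / 10 : ℝ) * e.admMass D ≤ Real.sqrt ((⨅ (V : TopologicalSpace.Opens X) (_ : IsCalS V ∧ V ≤ S.exterior), Literature.Geometry.Lorentzian.area D.h (frontier (V : Set X))).toReal / (16 * Real.pi))); ∀ d ∈ Literature.Geometry.Lorentzian.admissibleVacuumData X, ¬ P d → (¬ K pert d ∧ ¬ K collar d ∧ ¬ K shell d ∧ ¬ Mink d) → Hor d → (∃ (l : ℝ) (hl : 0 < l), K pert (Literature.Geometry.Lorentzian.InitialDataSet.homothety d l hl) ∨ K collar (Literature.Geometry.Lorentzian.InitialDataSet.homothety d l hl) ∨ K shell (Literature.Geometry.Lorentzian.InitialDataSet.homothety d l hl) ∨ Mink (Literature.Geometry.Lorentzian.InitialDataSet.homothety d l hl)) → ∃ (e : Literature.Geometry.Lorentzian.AFEnd X) (F : EuclideanSpace ℝ (Fin 1) → Literature.Geometry.Lorentzian.InitialDataSet (𝓡 3) X), Literature.Geometry.Lorentzian.InitialDataSet.IsTameDataFamily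 e 1 F ∧ Literature.Geometry.Lorentzian.InitialDataSet.IsImmersedAtZero 1 F ∧ F 0 = d ∧ Injective F ∧ (∀ c, F c ∈ Literature.Geometry.Lorentzian.admissibleVacuumData X) ∧ ∀ c ≠ 0, P (F c)

-- parent: HorizonDominatedResidual · glue (gen 1)
/--     item stmt-FinalStateConjecture-29339 · support · rank 505 · open
    parent: HorizonDominatedResidual · GLUE: children ⟹ parent · by planner
ScaledModelCapture → TimeSymmetricPenroseCeiling → DynamicalPenroseCeiling → GenuineHorizonDominated
→ HorizonDominatedResidual -/
@[route_item "route-FinalStateConjecture-RootDecompHorizonLadder"]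
def HorizonDominatedResidualGlue : Prop :=
  ScaledModelCapture → TimeSymmetricPenroseCeiling → DynamicalPenroseCeiling → GenuineHorizonDominated → HorizonDominatedResidual

/-- item stmt-FinalStateConjecture-25092 · crux · rank 6 · open · by planner
why it might fail: β = 1 is an absolute radius while every printed basin ε(M, χ) is inexplicit and non-uniform; data 1-close to a small-mass Kerr anchor are relatively large perturbations and may collapse further or radiate away the hole.
sources: KlainermanSzeftel2023, arXiv:2205.14808, Hintz2026, arXiv:2104.08222
[crux] PIECE rung 0→1 — PerturbativeCapture at (s, δ, β, χ̄, ρ̄, β₀) = (6, −1, 1, 9/10, 3, 1)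
[WEAKER; critic: «DECORATIVE-by-claim (β → 0⁺) / UNDECIDED[effective ε], ATTACKABLE (porting) — NOT
COUNTED»; at the typed β = 1 OPEN only by effectivity of the printed ε(M, χ) and scale
non-covariance (lens H2); leaf ATTACKABLE (porting
`klainerman_szeftel_kerr_stability_small_a_cauchy`, `hintz_kerr_stability_subextremal_cauchy`
through the lens's `onCell_of_forall_settles`) + IDEA-NEEDED (effective basin radius)]. For every Σ
and every admissible P_Σ-exceptional datum d in the perturbative Kerr window cell (spin ratio ≤
9/10, horizon-penetrating depth, b-conormal and 1-close at order 6, weight −1, to sub-extremal Kerr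
data along a cocompact embedded Kerr slice), there are one end e and a tame immersed injective
admissible one-parameter family F with F 0 = d whose members c ≠ 0 satisfy P_Σ. [difficulty: XL] -/
@[route_item "route-FinalStateConjecture-RootDecompHorizonLadder", crux]
def PerturbativeCapture : Prop :=
  ∀ (X : Type) [TopologicalSpace X] [ChartedSpace Literature.Geometry.Lorentzian.E3 X] [IsManifold (𝓡 3) ((⊤ : ℕ∞) : WithTop ℕ∞) X] [T2Space X] [SecondCountableTopology X] [ConnectedSpace X], let P : Literature.Geometry.Lorentzian.InitialDataSet (𝓡 3) X → Prop := fun D ↦ (∃ 𝒟 : Literature.Geometry.Lorentzian.VacuumCauchyDevelopment D, 𝒟.IsMaximal) ∧ ∀ 𝒟 : Literature.Geometry.Lorentzian.VacuumCauchyDevelopment D, 𝒟.IsMaximal → Summit.FinalStateConjecture.HasCompleteNullInfinity 𝒟.toCauchyDevelopment ∧ ∃ (O : Set 𝒟.carrier) (d : Literature.Geometry.Lorentzian.FinalStateDecomposition 𝒟.toSpacetime O 2), (∀ i, Literature.Geometry.Lorentzian.Kerr.IsSubextremal (d.mass i) (d.spin i)) ∧ O = Summit.FinalStateConjecture.exteriorOf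 𝒟.toCauchyDevelopment d.charted ∧ Summit.FinalStateConjecture.RaysStayInClosure 𝒟.toCauchyDevelopment O ∧ Summit.FinalStateConjecture.HasExhaustiveCharts d ∧ Summit.FinalStateConjecture.IsFutureOriented d; let K : Set (ℝ × ℝ) → Literature.Geometry.Lorentzian.InitialDataSet (𝓡 3) X → Prop := fun W D ↦ ∀ [Literature.Geometry.Lorentzian.Kerr.Facts] [Literature.Geometry.Lorentzian.Kerr.SliceFacts], ∃ (M a r₀ : ℝ) (hM : 0 < M), |a| < M ∧ (|a| / M, r₀ / M) ∈ W ∧ ∃ (θ : Literature.Geometry.Lorentzian.Kerr.slice a r₀ → X) (hθ : ContMDiff 𝓘(ℝ, Literature.Geometry.Lorentzian.E3) (𝓡 3) (((⊤ : ℕ∞) : WithTop ℕ∞) + 1) θ) (hθ' : ∀ u, Injective (mfderiv 𝓘(ℝ, Literature.Geometry.Lorentzian.E3) (𝓡 3) θ u)), Topology.IsOpenEmbedding θ ∧ IsCompact (range θ)ᶜ ∧ (∀ s' : ℕ, Literature.Geometry.Lorentzian.InitialDataSet.dataWeightedSobolevEDist s' (-1 : ℝ) (D.comap θ hθ hθ')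 (Literature.Geometry.Lorentzian.Kerr.data M a r₀ hM.le) < ⊤) ∧ Literature.Geometry.Lorentzian.InitialDataSet.dataWeightedSobolevEDist 6 (-1 : ℝ) (D.comap θ hθ hθ') (Literature.Geometry.Lorentzian.Kerr.data M a r₀ hM.le) < ENNReal.ofReal 1; let pert : Set (ℝ × ℝ) := {p | p.1 ≤ (9 / 10 : ℝ) ∧ 1 - Real.sqrt (1 - p.1 ^ 2) < p.2 ∧ p.2 < 1 + Real.sqrt (1 - p.1 ^ 2)}; ∀ d ∈ Literature.Geometry.Lorentzian.admissibleVacuumData X, ¬ P d → K pert d → ∃ (e : Literature.Geometry.Lorentzian.AFEnd X) (F : EuclideanSpace ℝ (Fin 1) → Literature.Geometry.Lorentzian.InitialDataSet (𝓡 3) X), Literature.Geometry.Lorentzian.InitialDataSet.IsTameDataFamily e 1 F ∧ Literature.Geometry.Lorentzian.InitialDataSet.IsImmersedAtZero 1 F ∧ F 0 = d ∧ Injective F ∧ (∀ c, F c ∈ Literature.Geometry.Lorentzian.admissibleVacuumData X) ∧ ∀ c ≠ 0, P (F c)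

/-- item stmt-FinalStateConjecture-25093 · crux · rank 7 · open · by planner
why it might fail: no explicit Christodoulou–Klainerman radius is in print; β₀ = 1 in H^6_(−1) may exceed the true dispersive basin, letting some cell data collapse to a black hole whose settling is then the full problem.
sources: ChristodoulouKlainerman1993, arXiv:2108.13379, LindbladRodnianski2010, Bieri2009
[crux] PIECE rung 0′ — SmallDataDispersal at (s, δ, β, χ̄, ρ̄, β₀) = (6, −1, 1, 9/10, 3, 1) [WEAKER;
critic: «same (CK93) — NOT COUNTED»; DECORATIVE in the limit β₀ → 0⁺ by
`christodoulou_klainerman_stability_minkowski_cauchy`; at β₀ = 1 open by effectivity only; leaf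
ATTACKABLE (porting of gr.S07-cauchy) + effective part IDEA-NEEDED]. For every Σ and every
admissible P_Σ-exceptional datum d in the Minkowski cell (Σ globally a copy of ℝ³ via a surjective
smooth open embedding θ of the Minkowski slice, θ^*d b-conormal and 1-close at order 6, weight −1,
to the trivial data), there are one end e and a tame immersed injective admissible one-parameter
family F with F 0 = d whose members c ≠ 0 satisfy P_Σ. [difficulty: XL] -/
@[route_item "route-FinalStateConjecture-RootDecompHorizonLadder", crux]
def SmallDataDispersal : Prop :=
  ∀ (X : Type) [TopologicalSpace X] [ChartedSpace Literature.Geometry.Lorentzian.E3 X] [IsManifold (𝓡 3) ((⊤ : ℕ∞) : WithTop ℕ∞) X] [T2Space X] [SecondCountableTopology X] [ConnectedSpace X], let P : Literature.Geometry.Lorentzian.InitialDataSet (𝓡 3) X → Prop := fun D ↦ (∃ 𝒟 : Literature.Geometry.Lorentzian.VacuumCauchyDevelopment D, 𝒟.IsMaximal) ∧ ∀ 𝒟 : Literature.Geometry.Lorentzian.VacuumCauchyDevelopment D, 𝒟.IsMaximal → Summit.FinalStateConjecture.HasCompleteNullInfinity 𝒟.toCauchyDevelopment ∧ ∃ (O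 : Set 𝒟.carrier) (d : Literature.Geometry.Lorentzian.FinalStateDecomposition 𝒟.toSpacetime O 2), (∀ i, Literature.Geometry.Lorentzian.Kerr.IsSubextremal (d.mass i) (d.spin i)) ∧ O = Summit.FinalStateConjecture.exteriorOf 𝒟.toCauchyDevelopment d.charted ∧ Summit.FinalStateConjecture.RaysStayInClosure 𝒟.toCauchyDevelopment O ∧ Summit.FinalStateConjecture.HasExhaustiveCharts d ∧ Summit.FinalStateConjecture.IsFutureOriented d; let Mink : Literature.Geometry.Lorentzian.InitialDataSet (𝓡 3) X → Prop := fun D ↦ ∃ (θ : Literature.Geometry.Lorentzian.Minkowski.slice → X) (hθ : ContMDiff 𝓘(ℝ, Literature.Geometry.Lorentzian.E3) (𝓡 3) (((⊤ : ℕ∞) : WithTop ℕ∞) + 1) θ) (hθ' : ∀ u, Injective (mfderiv 𝓘(ℝ, Literature.Geometry.Lorentzian.E3) (𝓡 3) θ u)), Topology.IsOpenEmbedding θ ∧ Surjective θ ∧ (∀ s' : ℕ, Literature.Geometry.Lorentzian.InitialDataSet.dataWeightedSobolevEDist s' (-1 : ℝ) (D.comap θ hθ hθ') Literature.Geometry.Lorentzian.trivialData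 < ⊤) ∧ Literature.Geometry.Lorentzian.InitialDataSet.dataWeightedSobolevEDist 6 (-1 : ℝ) (D.comap θ hθ hθ') Literature.Geometry.Lorentzian.trivialData < ENNReal.ofReal 1; ∀ d ∈ Literature.Geometry.Lorentzian.admissibleVacuumData X, ¬ P d → Mink d → ∃ (e : Literature.Geometry.Lorentzian.AFEnd X) (F : EuclideanSpace ℝ (Fin 1) → Literature.Geometry.Lorentzian.InitialDataSet (𝓡 3) X), Literature.Geometry.Lorentzian.InitialDataSet.IsTameDataFamily e 1 F ∧ Literature.Geometry.Lorentzian.InitialDataSet.IsImmersedAtZero 1 F ∧ F 0 = d ∧ Injective F ∧ (∀ c, F c ∈ Literature.Geometry.Lorentzian.admissibleVacuumData X) ∧ ∀ c ≠ 0, P (F c)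

/-- item stmt-FinalStateConjecture-27185 · assembly · rank 1 · open · by planner
sources: Christodoulou1999
[assembly] PerturbativeCapture → NearExtremalCapture → EnclosedCoreCapture → SmallDataDispersal →
HorizonDominatedResidual → SubPenroseResidual → the final state conjecture as typed. -/
@[route_item "route-FinalStateConjecture-RootDecompHorizonLadder"]
def Assembly : Prop :=
  PerturbativeCapture → NearExtremalCapture → EnclosedCoreCapture → SmallDataDispersal → HorizonDominatedResidual → SubPenroseResidual → FinalStateConjecture

/-! D-0027 §2.1 — DECIDING THEOREM (planner-authored via `route open/edit --closes-file`; by planner-decomp-fsc-writer-1-g0-0 2026-08-30T03:58:38Z):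
its hypotheses are this route's items and its conclusion the sub-problem Statement (glue_lint), and it elaborates with this file. -/

@[closes "route-FinalStateConjecture-RootDecompHorizonLadder"] theorem closes (h₀ : PerturbativeCapture) (h₁ : NearExtremalCapture) (h₂ : EnclosedCoreCapture)
    (h₃ : SmallDataDispersal) (hA : HorizonDominatedResidual) (hB : SubPenroseResidual) : _root_.FinalStateConjecture := by
  intro X _ _ _ _ _ _ d hd
  suffices h : ∃ (e : Literature.Geometry.Lorentzian.AFEnd X) (F : EuclideanSpace ℝ (Fin 1) → Literature.Geometry.Lorentzian.InitialDataSet (𝓡 3) X), Literature.Geometry.Lorentzian.InitialDataSet.IsTameDataFamily e 1 F ∧ Literature.Geometry.Lorentzian.InitialDataSet.IsImmersedAtZero 1 F ∧ F 0 = d ∧ Injective F ∧ (∀ c, F c ∈ Literature.Geometry.Lorentzian.admissibleVacuumData X) ∧ ∀ c ≠ 0, ((∃ 𝒟 : Literature.Geometry.Lorentzian.VacuumCauchyDevelopment (F c), 𝒟.IsMaximal) ∧ ∀ 𝒟 : Literature.Geometry.Lorentzian.VacuumCauchyDevelopment (F c), 𝒟.IsMaximal → Summit.FinalStateConjecture.HasCompleteNullInfinity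 𝒟.toCauchyDevelopment ∧ ∃ (O : Set 𝒟.carrier) (d : Literature.Geometry.Lorentzian.FinalStateDecomposition 𝒟.toSpacetime O 2), (∀ i, Literature.Geometry.Lorentzian.Kerr.IsSubextremal (d.mass i) (d.spin i)) ∧ O = Summit.FinalStateConjecture.exteriorOf 𝒟.toCauchyDevelopment d.charted ∧ Summit.FinalStateConjecture.RaysStayInClosure 𝒟.toCauchyDevelopment O ∧ Summit.FinalStateConjecture.HasExhaustiveCharts d ∧ Summit.FinalStateConjecture.IsFutureOriented d) by
    obtain ⟨e, F, h1, h2, h3, h4, h5, h6⟩ := h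
    exact ⟨e, F, h1, h2, h3, h4, h5, fun c hc hmem ↦ hmem.2 (h6 c hc)⟩
  by_cases c₀ : ∀ [Literature.Geometry.Lorentzian.Kerr.Facts] [Literature.Geometry.Lorentzian.Kerr.SliceFacts], ∃ (M a r₀ : ℝ) (hM : 0 < M), |a| < M ∧ (|a| / M, r₀ / M) ∈ {p | p.1 ≤ (9 / 10 : ℝ) ∧ 1 - Real.sqrt (1 - p.1 ^ 2) < p.2 ∧ p.2 < 1 + Real.sqrt (1 - p.1 ^ 2)} ∧ ∃ (θ : Literature.Geometry.Lorentzian.Kerr.slice a r₀ → X) (hθ : ContMDiff 𝓘(ℝ, Literature.Geometry.Lorentzian.E3) (𝓡 3) (((⊤ : ℕ∞) : WithTop ℕ∞) + 1) θ) (hθ' : ∀ u, Injective (mfderiv 𝓘(ℝ, Literature.Geometry.Lorentzian.E3) (𝓡 3) θ u)), Topology.IsOpenEmbedding θ ∧ IsCompact (range θ)ᶜ ∧ (∀ s' : ℕ, Literature.Geometry.Lorentzian.InitialDataSet.dataWeightedSobolevEDist s' (-1 : ℝ) (d.comap θ hθ hθ') (Literature.Geometry.Lorentzian.Kerr.data M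 a r₀ hM.le) < ⊤) ∧ Literature.Geometry.Lorentzian.InitialDataSet.dataWeightedSobolevEDist 6 (-1 : ℝ) (d.comap θ hθ hθ') (Literature.Geometry.Lorentzian.Kerr.data M a r₀ hM.le) < ENNReal.ofReal 1
  · exact h₀ X d hd.1 hd.2 c₀
  by_cases c₁ : ∀ [Literature.Geometry.Lorentzian.Kerr.Facts] [Literature.Geometry.Lorentzian.Kerr.SliceFacts], ∃ (M a r₀ : ℝ) (hM : 0 < M), |a| < M ∧ (|a| / M, r₀ / M) ∈ {p | (9 / 10 : ℝ) < p.1 ∧ 1 - Real.sqrt (1 - p.1 ^ 2) < p.2 ∧ p.2 < 1 + Real.sqrt (1 - p.1 ^ 2)} ∧ ∃ (θ : Literature.Geometry.Lorentzian.Kerr.slice a r₀ → X) (hθ : ContMDiff 𝓘(ℝ, Literature.Geometry.Lorentzian.E3) (𝓡 3) (((⊤ : ℕ∞) : WithTop ℕ∞) + 1) θ) (hθ' : ∀ u, Injective (mfderiv 𝓘(ℝ, Literature.Geometry.Lorentzian.E3) (𝓡 3) θ u)), Topology.IsOpenEmbedding θ ∧ IsCompact (range θ)ᶜ ∧ (∀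 s' : ℕ, Literature.Geometry.Lorentzian.InitialDataSet.dataWeightedSobolevEDist s' (-1 : ℝ) (d.comap θ hθ hθ') (Literature.Geometry.Lorentzian.Kerr.data M a r₀ hM.le) < ⊤) ∧ Literature.Geometry.Lorentzian.InitialDataSet.dataWeightedSobolevEDist 6 (-1 : ℝ) (d.comap θ hθ hθ') (Literature.Geometry.Lorentzian.Kerr.data M a r₀ hM.le) < ENNReal.ofReal 1
  · exact h₁ X d hd.1 hd.2 c₁
  by_cases c₂ : ∀ [Literature.Geometry.Lorentzian.Kerr.Facts] [Literature.Geometry.Lorentzian.Kerr.SliceFacts], ∃ (M a r₀ : ℝ) (hM : 0 < M), |a| < M ∧ (|a| / M, r₀ / M) ∈ {p | 1 + Real.sqrt (1 - p.1 ^ 2) ≤ p.2 ∧ p.2 ≤ 3} ∧ ∃ (θ : Literature.Geometry.Lorentzian.Kerr.slice a r₀ → X) (hθ : ContMDiff 𝓘(ℝ, Literature.Geometry.Lorentzian.E3) (𝓡 3) (((⊤ : ℕ∞) : WithTop ℕ∞) + 1) θ) (hθ' : ∀ u, Injective (mfderiv 𝓘(ℝ, Literature.Geometry.Lorentzian.E3)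 (𝓡 3) θ u)), Topology.IsOpenEmbedding θ ∧ IsCompact (range θ)ᶜ ∧ (∀ s' : ℕ, Literature.Geometry.Lorentzian.InitialDataSet.dataWeightedSobolevEDist s' (-1 : ℝ) (d.comap θ hθ hθ') (Literature.Geometry.Lorentzian.Kerr.data M a r₀ hM.le) < ⊤) ∧ Literature.Geometry.Lorentzian.InitialDataSet.dataWeightedSobolevEDist 6 (-1 : ℝ) (d.comap θ hθ hθ') (Literature.Geometry.Lorentzian.Kerr.data M a r₀ hM.le) < ENNReal.ofReal 1
  · exact h₂ X d hd.1 hd.2 c₂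
  by_cases c₃ : ∃ (θ : Literature.Geometry.Lorentzian.Minkowski.slice → X) (hθ : ContMDiff 𝓘(ℝ, Literature.Geometry.Lorentzian.E3) (𝓡 3) (((⊤ : ℕ∞) : WithTop ℕ∞) + 1) θ) (hθ' : ∀ u, Injective (mfderiv 𝓘(ℝ, Literature.Geometry.Lorentzian.E3) (𝓡 3) θ u)), Topology.IsOpenEmbedding θ ∧ Surjective θ ∧ (∀ s' : ℕ, Literature.Geometry.Lorentzian.InitialDataSet.dataWeightedSobolevEDist s' (-1 : ℝ) (d.comap θ hθ hθ') Literature.Geometry.Lorentzian.trivialData < ⊤) ∧ Literature.Geometry.Lorentzian.InitialDataSet.dataWeightedSobolevEDist 6 (-1 : ℝ) (d.comap θ hθ hθ') Literature.Geometry.Lorentzian.trivialData < ENNReal.ofReal 1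
  · exact h₃ X d hd.1 hd.2 c₃
  -- the extended-field residual (stmt-25091) rebuilt from its born children by excluded middle on the horizon guard «Hor d»
  exact (Classical.em _).elim (fun hH ↦ hA X d hd.1 hd.2 ⟨c₀, c₁, c₂, c₃⟩ hH) (fun hH ↦ hB X d hd.1 hd.2 ⟨c₀, c₁, c₂, c₃⟩ hH)

end Summit.FinalStateConjecture.FinalStateConjecture.Theses.RootDecompHorizonLadder
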